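import Literature.ComputerArithmetic.RumpOgitaOishi2009.AccSign

/-!
# Rump–Ogita–Oishi, *Accurate floating-point summation part II* (SIAM J. Sci. Comput. 31 (2008/09),
# 1269–1302): §8 "Vectors of huge length" — Algorithm 8.1 `AccSumHugeN` and Proposition 8.2

HONEST FRAMING. This file belongs to the engines group's Literature anchors: shared numerical engines
serving client cells; rigour lives in the verifiers; every published number belongs to a client cell's
ledger, not to the engines group. The file types and PROVES a published theorem at format level
(floating-point numbers `F = F(p, emin) ⊆ ℚ`, `fl` any rounding to nearest, no overflow); it files no
problem-side mathematics.

Source read at the page: S. M. Rump, T. Ogita, S. Oishi, *Accurate floating-point summation part II: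
sign, K-fold faithful and rounding to nearest*, authors' version (30 pp.), pp. 19–22 = §8: Algorithm 8.1
(`AccSumHugeN`), Proposition 8.2 with Remarks 1–4, its proof (eqs. (8.1)–(8.18)), Table 8.1 and eq. (8.19).
Part I = [cite: RumpOgitaOishi2008] (`AccSum.lean`, `ExtractVector.lean`); §3 of Part II (`Transform` with
the parameter `Φ`, Lemma 3.4) = `AccSign.lean`.

THE ALGORITHM (p. 19). "All algorithms presented so far use as their first step the error-free
transformation `Transform` of the input vector … So far, all results were proved under the assumption
`2^(2M)eps ≤ 1`, where `M := ⌈log₂(n + 2)⌉`" — about `6.7·10⁷` summands in double, `4094` in single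
precision. `AccSumHugeN` weakens it to `2^(M+3)eps ≤ 1`:
```
  function res = AccSumHugeN(p)
    [τ₁, τ₂, q⁽⁰⁾, σ] = Transform(p)          % parameter Φ replaced by 2^(M+3) eps
    if σ ≤ ½eps⁻¹eta, res = τ₁, return, end if
    k = 0;  σ₀' = fl((2^M eps) σ)
    repeat  k = k + 1;  [τ_k', q⁽ᵏ⁾] = ExtractVector(σ_{k-1}', q⁽ᵏ⁻¹⁾);  σ_k' = fl((2^M eps) σ_{k-1}')
    until fl((2^(2M+1) eps) σ_{k-1}') ≤ |τ₁| or σ_{k-1}' ≤ ½eps⁻¹eta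
    K = k;  τ_{K+1}' = fl(τ₂ + float(Σᵢ q⁽ᴷ⁾ᵢ))
    res = fl(τ₁ + fl(τ₁' + fl(τ₂' + fl(… + fl(τ_K' + τ_{K+1}') …))))
```

DICTIONARY (as in `AccSign.lean` / `AccSum.lean`). `eps ↦ unitRoundoff p = 2⁻ᵖ`; `½eps⁻¹eta ↦ 2^(emin+p-1)`;
`M ↦ Nat.clog 2 (n + 2)`; `Transform` with `Φ = 2^(M+3)eps` ↦ `transformPhi fl p emin (2^(M+3)·u) xs 0`
(`hugeNTransform`); the `repeat–until` loop ↦ `hugeNLoop` (structural recursion on a fuel `≥ k − emin + 1`,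
which provably suffices since `σ_k' = 2^(M−p)σ_{k−1}'` strictly decreases the exponent while the loop runs);
the nested sum `fl(τ₁' + fl(τ₂' + … fl(τ_K' + c)…))` ↦ `nestedFlSum fl [τ₁', …, τ_K'] c`;
`float(Σ q⁽ᴷ⁾ᵢ)` ↦ `flSum fl` (recursive summation; any order would do, the bounds used are (2.20)-type
tree bounds); faithful rounding ↦ `IsFaithfulRounding` (Part I, Definition 2.1 / `AccSum.lean`).

Typed and PROVED here (0 `sorry`):
* `accSumHugeN` — ALGORITHM 8.1, with `hugeNTransform`, `hugeNLoop`, `hugeNExtract`, `nestedFlSum`;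
* `HugeNInv` + `hugeNLoop_spec` — the state (8.7) produced by the loop: `σ_k' = ϕᵏσ`, `|τ_k'| < σ_{k−1}'`,
  `τ_k' ∈ F`, `Σ q⁽⁰⁾ = Σ τ_k' + Σ q⁽ᴷ⁾`, `|q⁽ᴷ⁾ᵢ| ≤ eps σ_{K−1}'`, and the exit alternative;
* `HugeNInv.three_mul_length_le` — (8.14) `K = 1 ∨ 3K ≤ M`; `HugeNInv.length_le_of` — (8.19)/Table 8.1:
  `(K+1)M ≤ pK + 2 ⟹` at most `K` passes (`hugeNExtract_length`, `hugeNExtract_length_le_of`);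
* `nestedFlSum_spec` — (8.10), (8.12), (8.13): the nested floating-point sum and its error;
* `faithful_of_hugeNInv` — the analysis (8.1)–(8.18) ending in Part I, Lemma 2.5;
* `isFaithfulRounding_accSumHugeN` — **PROPOSITION 8.2**: `res` is a faithful rounding of `s := Σ pᵢ`
  under `2^(M+3)eps ≤ 1` and `eps ≤ 1/512`; `isFaithfulRounding_accSumHugeN_printed` — verbatim with the
  printed extra hypothesis `1 < 2^(2M)eps`; `isFaithful_accSumHugeN` — the same in the vocabulary
  `BoldoJeannerodMelquiondMuller2023.IsFaithful` of [cite: BoldoEtAl2023]; `clog_add_three_le_iff` —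
  Remark 1 (`n + 2 ≤ 2^(p−3)`).

NOTES. (a) Hypotheses: `2^(M+3)eps ≤ 1 ↦ Nat.clog 2 (n+2) + 3 ≤ p`; `eps ≤ 1/512 ↦ 9 ≤ p`. The printed
hypothesis `1 < 2^(2M)eps` ("we may assume … because otherwise we can use Algorithm 4.5 (AccSum)", and
Remark 4: it can be dropped when `ExtractVector` skips zero summands) enters the printed proof only through
`M ≥ 5` in (8.14) `K ≤ M/3`; we prove instead `K = 1 ∨ 3K ≤ M` (hence `3K ≤ p`, all that (8.15) needs) without
it, so the main theorem `isFaithfulRounding_accSumHugeN` holds for every length `n` with `2^(M+3)eps ≤ 1`;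
the verbatim statement is `isFaithfulRounding_accSumHugeN_printed`. In the no-overflow model the quantities
`fl((2^M eps)σ_{k−1}')` and `fl((2^(2M+1)eps)σ_{k−1}')` are computed exactly whenever `σ_{k−1}' > ½eps⁻¹eta`
(powers of two `≥ eta`), which is all the proof uses. (b) The second "without loss of generality" of the
printed proof (eq. (8.6), `|τ₁| ≥ eps⁻¹eta`) is the case split in `faithful_of_hugeNInv`: for `|τ₁| < eps⁻¹eta`
one has `K = 1`, `q⁽¹⁾ = 0`, `τ₂ = 0` and `res = fl(τ₁ + τ₁') = fl(s)`. (c) Not typed: the flop counts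
`(4M+3)n` / Remark 3, Remark 2 (comparison with `AccSum`), and the numerical Table 8.1 itself (its content is
the implication (8.19), typed as `HugeNInv.length_le_of`).
-/

namespace Literature.ComputerArithmetic.RumpOgitaOishi2009

open Literature.ComputerArithmetic.JeannerodRump2018
open Literature.ComputerArithmetic.JeannerodRump2018.SumTree
open Literature.ComputerArithmetic.BoldoJeannerodMelquiondMuller2023
open Literature.ComputerArithmetic.JoldesMullerPopescu2017 (isFloat_two_zpow two_zpow_emin_le_abs)
open Literature.ComputerArithmetic.LangeRump2018 (abs_list_sum_le exact_eq_leaves_sum)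
open Literature.ComputerArithmetic.RumpOgitaOishi2008

variable {p : ℕ} {emin : ℤ} {fl : ℚ → ℚ}

/-! ### §8: Algorithm 8.1 `AccSumHugeN` -/

/-- ALGORITHM 8.1, the `repeat–until` loop, entered with `σ' = σ_{k−1}'` and `q = q⁽ᵏ⁻¹⁾`:
`[τ_k', q⁽ᵏ⁾] = ExtractVector(σ_{k−1}', q⁽ᵏ⁻¹⁾)`, `σ_k' = fl((2ᴹeps)σ_{k−1}')`,
`until fl((2^(2M+1)eps)σ_{k−1}') ≤ |τ₁| or σ_{k−1}' ≤ ½eps⁻¹eta` (`a = |τ₁|`, `eta₂ = ½eps⁻¹eta`). Returns the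
list `[τ_k', …, τ_K']` and the final vector `q⁽ᴷ⁾`; structural recursion on a fuel (see `hugeNLoop_spec`:
a fuel `> log₂σ' − emin` is never exhausted). [cite: RumpOgitaOishi2009, Algorithm 8.1 (repeat–until loop)] -/
def hugeNLoop (fl : ℚ → ℚ) (M : ℕ) (u eta₂ a : ℚ) : ℕ → ℚ → List ℚ → List ℚ × List ℚ
  | 0, _, q => ([], q)
  | fuel + 1, σ', q =>
      if fl (2 ^ (2 * M + 1) * u * σ') ≤ a ∨ σ' ≤ eta₂ then
        ([(extractVector fl σ' q).1], (extractVector fl σ' q).2)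
      else
        ((extractVector fl σ' q).1 ::
            (hugeNLoop fl M u eta₂ a fuel (fl (2 ^ M * u * σ')) (extractVector fl σ' q).2).1,
          (hugeNLoop fl M u eta₂ a fuel (fl (2 ^ M * u * σ')) (extractVector fl σ' q).2).2)

/-- ALGORITHM 8.1, last line: the nested floating-point sum `fl(τ₁' + fl(τ₂' + fl(… + fl(τ_K' + c)…)))`
of a list `[τ₁', …, τ_K']` onto a start value `c` (`= τ_{K+1}'`).
[cite: RumpOgitaOishi2009, Algorithm 8.1 (last line)] -/
def nestedFlSum (fl : ℚ → ℚ) : List ℚ → ℚ → ℚ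
  | [], c => c
  | τ :: τs, c => fl (τ + nestedFlSum fl τs c)

/-- ALGORITHM 8.1, first line: `[τ₁, τ₂, q⁽⁰⁾, σ] = Transform(p)` with "the parameter `Φ` replaced by
`2^(M+3)eps`" (Algorithm 3.3 with `ϱ = 0`). [cite: RumpOgitaOishi2009, Algorithm 8.1 (first line)] -/
def hugeNTransform (fl : ℚ → ℚ) (p : ℕ) (emin : ℤ) (xs : List ℚ) : ℚ × ℚ × List ℚ × ℚ :=
  transformPhi fl p emin (2 ^ (Nat.clog 2 (xs.length + 2) + 3) * unitRoundoff p) xs 0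

/-- ALGORITHM 8.1, lines 4–9: `σ₀' = fl((2ᴹeps)σ)` and the extraction loop, producing `[τ₁', …, τ_K']` and
`q⁽ᴷ⁾` (fuel `log₂σ − emin + 1`). [cite: RumpOgitaOishi2009, Algorithm 8.1 (lines 4–9)] -/
def hugeNExtract (fl : ℚ → ℚ) (p : ℕ) (emin : ℤ) (xs : List ℚ) : List ℚ × List ℚ :=
  hugeNLoop fl (Nat.clog 2 (xs.length + 2)) (unitRoundoff p) ((2 : ℚ) ^ (emin + p - 1))
    |(hugeNTransform fl p emin xs).1|
    ((Int.log 2 (hugeNTransform fl p emin xs).2.2.2 - emin).toNat + 1)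
    (fl (2 ^ Nat.clog 2 (xs.length + 2) * unitRoundoff p * (hugeNTransform fl p emin xs).2.2.2))
    (hugeNTransform fl p emin xs).2.2.1

/-- **ALGORITHM 8.1 (`AccSumHugeN`): accurate summation with faithful rounding for huge `n`.**
`res = τ₁` if `σ ≤ ½eps⁻¹eta`; otherwise `τ_{K+1}' = fl(τ₂ + float(Σ q⁽ᴷ⁾ᵢ))` and
`res = fl(τ₁ + fl(τ₁' + fl(τ₂' + … + fl(τ_K' + τ_{K+1}')…)))`. [cite: RumpOgitaOishi2009, Algorithm 8.1] -/
def accSumHugeN (fl : ℚ → ℚ) (p : ℕ) (emin : ℤ) (xs : List ℚ) : ℚ :=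
  if (hugeNTransform fl p emin xs).2.2.2 ≤ (2 : ℚ) ^ (emin + p - 1) then (hugeNTransform fl p emin xs).1
  else
    fl ((hugeNTransform fl p emin xs).1 +
      nestedFlSum fl (hugeNExtract fl p emin xs).1
        (fl ((hugeNTransform fl p emin xs).2.1 + flSum fl (hugeNExtract fl p emin xs).2)))

/-- Remark 1 after Proposition 8.2: the restriction `2^(M+3)eps ≤ 1`, `M = ⌈log₂(n + 2)⌉`, reads
`n + 2 ≤ 2^(p−3)` ("a little over 2 million in IEEE 754 single precision … `1.1·10¹⁵` in double precision").
[cite: RumpOgitaOishi2009, Proposition 8.2, Remark 1] -/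
theorem clog_add_three_le_iff (hp : 3 ≤ p) (n : ℕ) :
    Nat.clog 2 (n + 2) + 3 ≤ p ↔ n + 2 ≤ 2 ^ (p - 3) := by
  rw [show Nat.clog 2 (n + 2) + 3 ≤ p ↔ Nat.clog 2 (n + 2) ≤ p - 3 by omega,
    Nat.clog_le_iff_le_pow (by norm_num)]

/-- For the zero vector `Transform` returns `τ₁ = τ₂ = σ = 0`, and `AccSumHugeN` returns `res = τ₁ = 0`.
[cite: RumpOgitaOishi2009, Algorithm 8.1 (line 2) / Algorithm 3.3 (line 2)] -/
theorem accSumHugeN_of_maxAbs_eq_zero (fl : ℚ → ℚ) (p : ℕ) (emin : ℤ) {xs : List ℚ}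
    (h : maxAbs xs = 0) : accSumHugeN fl p emin xs = 0 := by
  have hT : hugeNTransform fl p emin xs = (0, 0, xs, 0) := transformPhi_of_maxAbs_eq_zero fl p emin _ 0 h
  rw [accSumHugeN, hT]
  exact if_pos (two_zpow_pos _).le

/-- LEMMA 3.4 for the first line of Algorithm 8.1: for a nonzero input vector and `2^(M+3)eps ≤ 1` the
results `[τ₁, τ₂, q⁽⁰⁾, σ]` of `Transform` (parameter `Φ = 2^(M+3)eps`, `ϱ = 0`) satisfy (3.2)–(3.5), which is
(8.1), (8.2), (8.3) and — for `σ > ½eps⁻¹eta` — (8.5) `Φσ ≤ |τ₁|`.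
[cite: RumpOgitaOishi2009, Proposition 8.2 (proof, eqs. (8.1)–(8.5)) / Lemma 3.4] -/
theorem hugeNTransform_spec (hp : 1 ≤ p) (hfl : IsRoundNearest p emin fl) {xs : List ℚ}
    (hxs : ∀ x ∈ xs, IsFloat p emin x) (hne : maxAbs xs ≠ 0) (hM3 : Nat.clog 2 (xs.length + 2) + 3 ≤ p) :
    TransformPhiSpec p emin fl (Nat.clog 2 (xs.length + 2))
      (2 ^ (Nat.clog 2 (xs.length + 2) + 3) * unitRoundoff p) (xs.sum + 0) xs.length
      (hugeNTransform fl p emin xs).1 (hugeNTransform fl p emin xs).2.1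
      (hugeNTransform fl p emin xs).2.2.1 (hugeNTransform fl p emin xs).2.2.2 :=
  transformPhi_spec hp hfl hxs hne (by omega) hM3 (isFloat_zero p emin) (onGrid_zero _)

/-! ### Proposition 8.2, eq. (8.7): the state produced by the extraction loop -/

/-- The state after the `repeat–until` loop of Algorithm 8.1 started at `σ_{k−1}' = 2ʲ`, eq. (8.7) and the
lines around it: the list `[τ_k', …, τ_K']` is nonempty, every `τ_i' ∈ F` with `|τ_i'| < σ_{i−1}'` where
`σ_i' = ϕσ_{i−1}'`, `ϕ = 2ᴹeps` (the exponent drops by `p − M` per pass); while the loop continues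
`σ_{i−1}' > ½eps⁻¹eta` and `|τ₁| < 2^(2M+1)eps σ_{i−1}'` (the `until` condition fails); after the last pass
`|q⁽ᴷ⁾ᵢ| ≤ eps σ_{K−1}'`, `q⁽ᴷ⁾ᵢ ∈ F`, and the `until` condition holds: `σ_{K−1}' ≤ ½eps⁻¹eta` or
(`σ_{K−1}' > ½eps⁻¹eta` and) `2^(2M+1)eps σ_{K−1}' ≤ |τ₁|` (`a = |τ₁|`).
[cite: RumpOgitaOishi2009, Proposition 8.2 (proof, eq. (8.7))] -/
def HugeNInv (p : ℕ) (emin : ℤ) (M : ℕ) (a : ℚ) (qK : List ℚ) : ℤ → List ℚ → Prop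
  | _, [] => False
  | j, [τ] =>
      IsFloat p emin τ ∧ |τ| < (2 : ℚ) ^ j ∧
        (∀ x ∈ qK, IsFloat p emin x ∧ |x| ≤ unitRoundoff p * (2 : ℚ) ^ j) ∧
        ((2 : ℚ) ^ j ≤ (2 : ℚ) ^ (emin + p - 1) ∨
          ((2 : ℚ) ^ (emin + p - 1) < (2 : ℚ) ^ j ∧ 2 ^ (2 * M + 1) * unitRoundoff p * (2 : ℚ) ^ j ≤ a))
  | j, τ :: τ' :: rest =>
      IsFloat p emin τ ∧ |τ| < (2 : ℚ) ^ j ∧ (2 : ℚ) ^ (emin + p - 1) < (2 : ℚ) ^ j ∧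
        a < 2 ^ (2 * M + 1) * unitRoundoff p * (2 : ℚ) ^ j ∧
        HugeNInv p emin M a qK (j + M - p) (τ' :: rest)

/-- The state of a single (last) pass. [cite: RumpOgitaOishi2009, Proposition 8.2 (proof, eq. (8.7))] -/
theorem HugeNInv.single {M : ℕ} {a : ℚ} {qK : List ℚ} {j : ℤ} {τ : ℚ} (hτF : IsFloat p emin τ)
    (hτ : |τ| < (2 : ℚ) ^ j) (hq : ∀ x ∈ qK, IsFloat p emin x ∧ |x| ≤ unitRoundoff p * (2 : ℚ) ^ j)
    (hexit : (2 : ℚ) ^ j ≤ (2 : ℚ) ^ (emin + p - 1) ∨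
      ((2 : ℚ) ^ (emin + p - 1) < (2 : ℚ) ^ j ∧ 2 ^ (2 * M + 1) * unitRoundoff p * (2 : ℚ) ^ j ≤ a)) :
    HugeNInv p emin M a qK j [τ] := by
  simp only [HugeNInv]
  exact ⟨hτF, hτ, hq, hexit⟩

/-- The data of a single (last) pass. [cite: RumpOgitaOishi2009, Proposition 8.2 (proof, eq. (8.7))] -/
theorem HugeNInv.of_single {M : ℕ} {a : ℚ} {qK : List ℚ} {j : ℤ} {τ : ℚ}
    (h : HugeNInv p emin M a qK j [τ]) :
    IsFloat p emin τ ∧ |τ| < (2 : ℚ) ^ j ∧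
      (∀ x ∈ qK, IsFloat p emin x ∧ |x| ≤ unitRoundoff p * (2 : ℚ) ^ j) ∧
      ((2 : ℚ) ^ j ≤ (2 : ℚ) ^ (emin + p - 1) ∨
        ((2 : ℚ) ^ (emin + p - 1) < (2 : ℚ) ^ j ∧ 2 ^ (2 * M + 1) * unitRoundoff p * (2 : ℚ) ^ j ≤ a)) := by
  simp only [HugeNInv] at h
  exact h

/-- A continuing pass followed by the remaining ones. [cite: RumpOgitaOishi2009, Proposition 8.2 (proof, eq. (8.7))] -/
theorem HugeNInv.cons {M : ℕ} {a : ℚ} {qK : List ℚ} {j : ℤ} {τ : ℚ} {rest : List ℚ}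
    (hτF : IsFloat p emin τ) (hτ : |τ| < (2 : ℚ) ^ j) (hσ : (2 : ℚ) ^ (emin + p - 1) < (2 : ℚ) ^ j)
    (ha : a < 2 ^ (2 * M + 1) * unitRoundoff p * (2 : ℚ) ^ j)
    (h : HugeNInv p emin M a qK (j + M - p) rest) : HugeNInv p emin M a qK j (τ :: rest) := by
  cases rest with
  | nil => simp [HugeNInv] at h
  | cons τ' rest =>
      simp only [HugeNInv]
      exact ⟨hτF, hτ, hσ, ha, h⟩

/-- The list `[τ_k', …, τ_K']` is nonempty (`K ≥ 1`). [cite: RumpOgitaOishi2009, Proposition 8.2 (proof, eq. (8.7))] -/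
theorem HugeNInv.ne_nil {M : ℕ} {a : ℚ} {qK : List ℚ} {j : ℤ} {τs : List ℚ}
    (h : HugeNInv p emin M a qK j τs) : τs ≠ [] := by
  rintro rfl
  simp [HugeNInv] at h

/-- The first extracted part: `τ_k' ∈ F`, `|τ_k'| < σ_{k−1}'`. [cite: RumpOgitaOishi2009, Proposition 8.2 (proof, eq. (8.7))] -/
theorem HugeNInv.head {M : ℕ} {a : ℚ} {qK : List ℚ} {j : ℤ} {τ : ℚ} {rest : List ℚ}
    (h : HugeNInv p emin M a qK j (τ :: rest)) : IsFloat p emin τ ∧ |τ| < (2 : ℚ) ^ j := by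
  cases rest with
  | nil => simp only [HugeNInv] at h; exact ⟨h.1, h.2.1⟩
  | cons τ' rest => simp only [HugeNInv] at h; exact ⟨h.1, h.2.1⟩

/-- A continuing pass: `σ_{k−1}' > ½eps⁻¹eta` and `|τ₁| < 2^(2M+1)eps σ_{k−1}'` (the `until` condition fails,
both quantities being computed exactly). [cite: RumpOgitaOishi2009, Proposition 8.2 (proof, eq. (8.7))] -/
theorem HugeNInv.lt_two_pow {M : ℕ} {a : ℚ} {qK : List ℚ} {j : ℤ} {τ τ' : ℚ} {rest : List ℚ}
    (h : HugeNInv p emin M a qK j (τ :: τ' :: rest)) :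
    (2 : ℚ) ^ (emin + p - 1) < (2 : ℚ) ^ j ∧ a < 2 ^ (2 * M + 1) * unitRoundoff p * (2 : ℚ) ^ j := by
  simp only [HugeNInv] at h
  exact ⟨h.2.2.1, h.2.2.2.1⟩

/-- The remaining passes start at `σ_k' = ϕσ_{k−1}' = 2^(j+M−p)`. [cite: RumpOgitaOishi2009, Proposition 8.2 (proof, eq. (8.7))] -/
theorem HugeNInv.tail {M : ℕ} {a : ℚ} {qK : List ℚ} {j : ℤ} {τ τ' : ℚ} {rest : List ℚ}
    (h : HugeNInv p emin M a qK j (τ :: τ' :: rest)) : HugeNInv p emin M a qK (j + M - p) (τ' :: rest) := by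
  simp only [HugeNInv] at h
  exact h.2.2.2.2

/-- Eq. (8.7), the parts: `τ_k' ∈ F` and `|τ_k'| < σ_{k−1}' = ϕ^(k−1)σ₀'` along the list.
[cite: RumpOgitaOishi2009, Proposition 8.2 (proof, eq. (8.7))] -/
def HugeNTaus (p : ℕ) (emin : ℤ) (M : ℕ) : ℤ → List ℚ → Prop
  | _, [] => True
  | j, τ :: rest => (IsFloat p emin τ ∧ |τ| < (2 : ℚ) ^ j) ∧ HugeNTaus p emin M (j + M - p) rest

/-- Eq. (8.7) for the parts, extracted from the loop state. [cite: RumpOgitaOishi2009, Proposition 8.2 (proof, eq. (8.7))] -/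
theorem HugeNInv.taus {M : ℕ} {a : ℚ} {qK : List ℚ} :
    ∀ {j : ℤ} {τs : List ℚ}, HugeNInv p emin M a qK j τs → HugeNTaus p emin M j τs
  | _, [], h => (h.ne_nil rfl).elim
  | j, [τ], h => by
      obtain ⟨hτF, hτ, -, -⟩ := h.of_single
      simp only [HugeNTaus]
      exact ⟨⟨hτF, hτ⟩, trivial⟩
  | j, τ :: τ' :: rest, h => by
      have h1 := h.head
      have h2 := HugeNInv.taus h.tail
      simp only [HugeNTaus] at h2 ⊢
      exact ⟨h1, h2⟩

/-- Eq. (8.7) after the last pass `K = k + i` (entered at `σ_{k−1}' = 2ʲ`): `|q⁽ᴷ⁾ᵢ| ≤ eps σ_{K−1}'`,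
`σ_{K−1}' = 2^(j + i(M−p))`, `q⁽ᴷ⁾ᵢ ∈ F`, and the `until` alternative.
[cite: RumpOgitaOishi2009, Proposition 8.2 (proof, eq. (8.7), "|q⁽ᴷ⁾ᵢ| ≤ eps σ'_{K−1}")] -/
theorem HugeNInv.last {M : ℕ} {a : ℚ} {qK : List ℚ} :
    ∀ {j : ℤ} {τs : List ℚ}, HugeNInv p emin M a qK j τs →
      ∃ i : ℕ, τs.length = i + 1 ∧
        (∀ x ∈ qK, IsFloat p emin x ∧ |x| ≤ unitRoundoff p * (2 : ℚ) ^ (j + i * ((M : ℤ) - p))) ∧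
        ((2 : ℚ) ^ (j + i * ((M : ℤ) - p)) ≤ (2 : ℚ) ^ (emin + p - 1) ∨
          ((2 : ℚ) ^ (emin + p - 1) < (2 : ℚ) ^ (j + i * ((M : ℤ) - p)) ∧
            2 ^ (2 * M + 1) * unitRoundoff p * (2 : ℚ) ^ (j + i * ((M : ℤ) - p)) ≤ a))
  | _, [], h => (h.ne_nil rfl).elim
  | j, [τ], h => by
      obtain ⟨-, -, hq, hexit⟩ := h.of_single
      refine ⟨0, rfl, ?_, ?_⟩
      · simpa using hq
      · simpa using hexit
  | j, τ :: τ' :: rest, h => by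
      obtain ⟨i, hlen, hq, hexit⟩ := HugeNInv.last h.tail
      have he : j + M - p + i * ((M : ℤ) - p) = j + ((i + 1 : ℕ) : ℤ) * ((M : ℤ) - p) := by
        push_cast; ring
      refine ⟨i + 1, by simpa using hlen, ?_, ?_⟩
      · rw [← he]; exact hq
      · rw [← he]; exact hexit

/-- Counting passes: if `2ᵉ ≤ |τ₁|` and the loop ran `L ≥ 2` passes from `σ_{k−1}' = 2ʲ`, then the pass before
the last one did not stop, so `2ᵉ ≤ |τ₁| < 2^(2M+1)eps σ_{L−2}' = 2^(j + (L−2)(M−p) + 2M + 1 − p)`.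
[cite: RumpOgitaOishi2009, Proposition 8.2 (proof, eq. (8.14) / eq. (8.19))] -/
theorem HugeNInv.exp_lt {M : ℕ} {a : ℚ} {qK : List ℚ} {e : ℤ} (he : (2 : ℚ) ^ e ≤ a) :
    ∀ {j : ℤ} {τs : List ℚ}, HugeNInv p emin M a qK j τs → 2 ≤ τs.length →
      e + ((τs.length : ℤ) - 2) * ((p : ℤ) - M) < j + 2 * M + 1 - p
  | _, [], h, _ => (h.ne_nil rfl).elim
  | _, [_], _, h2 => by simp at h2
  | j, [τ, τ'], h, _ => by
      have ha := (h.lt_two_pow).2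
      rw [two_pow_mul_u_mul_two_zpow] at ha
      have hlt := (zpow_lt_zpow_iff_right₀ (by norm_num : (1 : ℚ) < 2)).mp (he.trans_lt ha)
      have hlen : (([τ, τ'] : List ℚ).length : ℤ) = 2 := by simp
      rw [hlen]; push_cast at hlt; linarith
  | j, τ :: τ' :: τ'' :: rest, h, _ => by
      have ha := (h.lt_two_pow).2
      rw [two_pow_mul_u_mul_two_zpow] at ha
      have hlt := (zpow_lt_zpow_iff_right₀ (by norm_num : (1 : ℚ) < 2)).mp (he.trans_lt ha)
      have IH := HugeNInv.exp_lt he h.tail (by simp)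
      simp only [List.length_cons, Nat.cast_add, Nat.cast_one] at IH ⊢
      push_cast at hlt
      nlinarith [IH, hlt]

/-- **Eq. (8.14)** (sharpened, see NOTES (a)): with `2^(M+3)eps ≤ 1` and (8.5) `|τ₁| ≥ Φσ = 8σ₀'` the loop
finishes after `K` passes with `K = 1` or `3K ≤ M` (printed: "`K ≤ (2M+4−p)/(p−M) ≤ M/3`", using `M ≥ 5`):
by `exp_lt`, `3 + 3(K−2) ≤ 3 + (K−2)(p−M) < 2M + 1 − p ≤ M − 2`.
[cite: RumpOgitaOishi2009, Proposition 8.2 (proof, eq. (8.14))] -/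
theorem HugeNInv.three_mul_length_le {M : ℕ} {a : ℚ} {qK : List ℚ} {j : ℤ} {τs : List ℚ}
    (h : HugeNInv p emin M a qK j τs) (ha : (2 : ℚ) ^ (j + 3) ≤ a) (hM3 : M + 3 ≤ p) :
    τs.length = 1 ∨ 3 * τs.length ≤ M := by
  rcases Nat.lt_or_ge τs.length 2 with hlt | hge
  · left
    cases τs with
    | nil => exact (h.ne_nil rfl).elim
    | cons x rest => simp only [List.length_cons] at hlt ⊢; omega
  · right
    have h1 := HugeNInv.exp_lt ha h hge
    have hd : (3 : ℤ) * ((τs.length : ℤ) - 2) ≤ ((τs.length : ℤ) - 2) * ((p : ℤ) - M) := by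
      have h0 : (0 : ℤ) ≤ (τs.length : ℤ) - 2 := by omega
      have h3 : (3 : ℤ) ≤ (p : ℤ) - M := by omega
      nlinarith
    have key : 3 * (τs.length : ℤ) ≤ (M : ℤ) := by linarith
    omega

/-- **Eq. (8.19) / Table 8.1**: "`AccSumHugeN` needs at most `K` repeat-until loops for huge vector lengths
up to `n + 2 ≤ 2^M` and `M` satisfying `(K + 1)M ≤ pK + 2`" (again from `exp_lt`: `K + 1` passes would give
`3 + (K−1)(p−M) < 2M + 1 − p`, i.e. `pK + 2 < (K+1)M`). For single precision `K = 1, 2, 3` up to `M = 13,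
16, 18`; for double `M = 27, 36, 40`. [cite: RumpOgitaOishi2009, eq. (8.19) / Table 8.1] -/
theorem HugeNInv.length_le_of {M : ℕ} {a : ℚ} {qK : List ℚ} {j : ℤ} {τs : List ℚ}
    (h : HugeNInv p emin M a qK j τs) (ha : (2 : ℚ) ^ (j + 3) ≤ a) (hMp : M ≤ p) {K : ℕ} (hK : 1 ≤ K)
    (h819 : (K + 1) * M ≤ p * K + 2) : τs.length ≤ K := by
  by_contra hlt
  have hge : K + 1 ≤ τs.length := by omega
  have h1 := HugeNInv.exp_lt ha h (by omega)
  have hd : (K : ℤ) * ((p : ℤ) - M) ≤ ((τs.length : ℤ) - 2) * ((p : ℤ) - M) + ((p : ℤ) - M) := by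
    have : ((τs.length : ℤ) - 2) * ((p : ℤ) - M) + ((p : ℤ) - M) = ((τs.length : ℤ) - 1) * ((p : ℤ) - M) := by
      ring
    rw [this]
    exact mul_le_mul_of_nonneg_right (by omega) (by omega)
  have h2 : (((K + 1) * M : ℕ) : ℤ) ≤ ((p * K + 2 : ℕ) : ℤ) := by exact_mod_cast h819
  push_cast at h2
  nlinarith

/-- **The extraction loop realises (8.7).** Entering a pass with `σ' = 2ʲ`, `j ≥ emin`, fuel `> j − emin`,
a vector `q` of length `n`, `n + 2 ≤ 2ᴹ`, of floating-point numbers bounded by `2⁻ᴹσ'`, and `2ᴹeps < 1`: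
Part I, Theorem 3.3/Lemma 3.4 (`extractVector_eft`) gives `τ' ∈ F`, `Σ q = τ' + Σ q'`, `|q'ᵢ| ≤ eps σ'`,
`|τ'| < σ'`; while the loop continues `σ' > ½eps⁻¹eta`, so that `fl((2ᴹeps)σ') = 2^(j+M−p)` and
`fl((2^(2M+1)eps)σ') = 2^(j+2M+1−p)` are exact ("note that this is `(2ᴹeps)ᵏσ` in Algorithm 8.1") and
`eps σ' = 2⁻ᴹ(ϕσ')`, the entry condition of the next pass. The exponent drops by `p − M ≥ 1` per pass, so the
fuel is never exhausted. [cite: RumpOgitaOishi2009, Proposition 8.2 (proof, eq. (8.7))] -/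
theorem hugeNLoop_spec (hp : 1 ≤ p) (hfl : IsRoundNearest p emin fl) {M : ℕ} (hM : M < p) {n : ℕ}
    (hnM : n + 2 ≤ 2 ^ M) (a : ℚ) :
    ∀ (fuel : ℕ) (j : ℤ) (q : List ℚ), emin ≤ j → j - emin < fuel → q.length = n →
      (∀ x ∈ q, IsFloat p emin x ∧ |x| ≤ (2 : ℚ) ^ (j - M)) →
      HugeNInv p emin M a
          (hugeNLoop fl M (unitRoundoff p) ((2 : ℚ) ^ (emin + p - 1)) a fuel ((2 : ℚ) ^ j) q).2 j
          (hugeNLoop fl M (unitRoundoff p) ((2 : ℚ) ^ (emin + p - 1)) a fuel ((2 : ℚ) ^ j) q).1 ∧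
        q.sum = (hugeNLoop fl M (unitRoundoff p) ((2 : ℚ) ^ (emin + p - 1)) a fuel ((2 : ℚ) ^ j) q).1.sum +
          (hugeNLoop fl M (unitRoundoff p) ((2 : ℚ) ^ (emin + p - 1)) a fuel ((2 : ℚ) ^ j) q).2.sum ∧
        (hugeNLoop fl M (unitRoundoff p) ((2 : ℚ) ^ (emin + p - 1)) a fuel ((2 : ℚ) ^ j) q).2.length = n
  | 0, j, q, hj, hfuel, _, _ => absurd hfuel (by push_cast; omega)
  | fuel + 1, j, q, hj, hfuel, hlen, hq => by
      have hnlt : q.length < 2 ^ M := by rw [hlen]; omega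
      have hdiv : (2 : ℚ) ^ j / 2 ^ M = (2 : ℚ) ^ (j - M) := by
        rw [zpow_sub₀ (by norm_num : (2 : ℚ) ≠ 0), zpow_natCast]
      have hq' : ∀ x ∈ q, IsFloat p emin x ∧ |x| ≤ (2 : ℚ) ^ j / 2 ^ M := by
        intro x hx; rw [hdiv]; exact hq x hx
      obtain ⟨hsum, hlo, hτabs, hnσ, -, -, hτF⟩ := extractVector_eft hp hfl hj hM hq' hnlt
      have hτlt : |(extractVector fl ((2 : ℚ) ^ j) q).1| < (2 : ℚ) ^ j := hτabs.trans_lt hnσ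
      simp only [hugeNLoop]
      set τ : ℚ := (extractVector fl ((2 : ℚ) ^ j) q).1 with hτdef
      set q₁ : List ℚ := (extractVector fl ((2 : ℚ) ^ j) q).2 with hq₁def
      have hlen₁ : q₁.length = n := by rw [hq₁def, length_extractVector_snd, hlen]
      have hq₁F : ∀ x ∈ q₁, IsFloat p emin x := isFloat_of_mem_extractVector_snd hfl _ q
      have hq₁ : ∀ x ∈ q₁, IsFloat p emin x ∧ |x| ≤ unitRoundoff p * (2 : ℚ) ^ j :=
        fun x hx => ⟨hq₁F x hx, hlo x hx⟩
      split_ifs with hstop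
      · -- the loop stops after this pass
        refine ⟨HugeNInv.single hτF hτlt hq₁ ?_, by simpa using hsum, hlen₁⟩
        by_cases hσ : (2 : ℚ) ^ j ≤ (2 : ℚ) ^ (emin + p - 1)
        · exact Or.inl hσ
        · have hσ' : (2 : ℚ) ^ (emin + p - 1) < (2 : ℚ) ^ j := not_le.mp hσ
          have hkp : emin + p ≤ j := by
            by_contra hlt
            exact hσ (zpow_le_zpow_right₀ (by norm_num) (by omega))
          -- `fl((2^(2M+1)eps)σ') = (2^(2M+1)eps)σ'`, a power of two `≥ eta`
          have hexact : fl (2 ^ (2 * M + 1) * unitRoundoff p * (2 : ℚ) ^ j) =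
              2 ^ (2 * M + 1) * unitRoundoff p * (2 : ℚ) ^ j := by
            rw [two_pow_mul_u_mul_two_zpow]
            exact fl_eq_self hfl (isFloat_two_zpow hp (by push_cast; omega))
          rcases hstop with h | h
          · rw [hexact] at h; exact Or.inr ⟨hσ', h⟩
          · exact absurd h hσ
      · -- the loop continues with `σ' ← fl((2ᴹeps)σ') = 2^(j+M−p)` and `q ← q'`
        obtain ⟨halt, hσgt⟩ := not_or.mp hstop
        have hσgt : (2 : ℚ) ^ (emin + p - 1) < (2 : ℚ) ^ j := not_le.mp hσgt
        have hkp : emin + p ≤ j := by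
          by_contra hlt
          have : (2 : ℚ) ^ j ≤ (2 : ℚ) ^ (emin + p - 1) := zpow_le_zpow_right₀ (by norm_num) (by omega)
          exact absurd hσgt (not_lt.mpr this)
        have hexact : fl (2 ^ (2 * M + 1) * unitRoundoff p * (2 : ℚ) ^ j) =
            2 ^ (2 * M + 1) * unitRoundoff p * (2 : ℚ) ^ j := by
          rw [two_pow_mul_u_mul_two_zpow]
          exact fl_eq_self hfl (isFloat_two_zpow hp (by push_cast; omega))
        have halt : a < 2 ^ (2 * M + 1) * unitRoundoff p * (2 : ℚ) ^ j := by
          rw [hexact] at halt; exact not_le.mp halt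
        have hσ' : fl (2 ^ M * unitRoundoff p * (2 : ℚ) ^ j) = (2 : ℚ) ^ (j + M - p) := by
          rw [two_pow_mul_u_mul_two_zpow]
          exact fl_eq_self hfl (isFloat_two_zpow hp (by omega))
        have hj' : emin ≤ j + M - p := by omega
        have hfuel' : j + M - p - emin < fuel := by push_cast at hfuel ⊢; omega
        have hq₁' : ∀ x ∈ q₁, IsFloat p emin x ∧ |x| ≤ (2 : ℚ) ^ (j + M - p - M) := by
          intro x hx
          refine ⟨hq₁F x hx, ?_⟩
          have := hlo x hx
          rwa [u_mul_two_zpow, show j - (p : ℤ) = j + M - p - M by ring] at this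
        obtain ⟨IH1, IH2, IH3⟩ := hugeNLoop_spec hp hfl hM hnM a fuel (j + M - p) q₁ hj' hfuel' hlen₁ hq₁'
        rw [hσ']
        refine ⟨HugeNInv.cons hτF hτlt hσgt halt IH1, ?_, IH3⟩
        dsimp only
        rw [List.sum_cons, hsum, IH2]; ring

/-- **The loop of Algorithm 8.1 on the results of `Transform`** (nonzero input, `σ = 2ᵏ > ½eps⁻¹eta`, so
`k ≥ emin + p` and `σ₀' = fl((2ᴹeps)σ) = 2^(k+M−p)` is exact; by (3.3) `|q⁽⁰⁾ᵢ| ≤ eps σ = 2⁻ᴹσ₀'`): the state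
(8.7) holds for `[τ₁', …, τ_K']`, `q⁽ᴷ⁾`, with `Σ q⁽⁰⁾ = Σ τ_k' + Σ q⁽ᴷ⁾`, and (8.5) `|τ₁| ≥ Φσ = 8σ₀'`.
[cite: RumpOgitaOishi2009, Proposition 8.2 (proof, eqs. (8.5), (8.7))] -/
theorem hugeNExtract_spec (hfl : IsRoundNearest p emin fl) {xs : List ℚ} (hxs : ∀ x ∈ xs, IsFloat p emin x)
    (hne : maxAbs xs ≠ 0) (hM3 : Nat.clog 2 (xs.length + 2) + 3 ≤ p)
    (hσ : (2 : ℚ) ^ (emin + p - 1) < (hugeNTransform fl p emin xs).2.2.2) :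
    ∃ k : ℤ, (hugeNTransform fl p emin xs).2.2.2 = (2 : ℚ) ^ k ∧ emin + p ≤ k ∧
      HugeNInv p emin (Nat.clog 2 (xs.length + 2)) |(hugeNTransform fl p emin xs).1|
        (hugeNExtract fl p emin xs).2 (k + Nat.clog 2 (xs.length + 2) - p) (hugeNExtract fl p emin xs).1 ∧
      (hugeNTransform fl p emin xs).2.2.1.sum =
        (hugeNExtract fl p emin xs).1.sum + (hugeNExtract fl p emin xs).2.sum ∧
      (hugeNExtract fl p emin xs).2.length = xs.length ∧
      (2 : ℚ) ^ (k + Nat.clog 2 (xs.length + 2) - p + 3) ≤ |(hugeNTransform fl p emin xs).1| := by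
  have hp : 1 ≤ p := by omega
  have hMp : Nat.clog 2 (xs.length + 2) < p := by omega
  have hnM : xs.length + 2 ≤ 2 ^ Nat.clog 2 (xs.length + 2) := Nat.le_pow_clog (by norm_num) _
  have H := hugeNTransform_spec hp hfl hxs hne hM3
  obtain ⟨k, -, hσk⟩ := H.two_zpow
  have hkp : emin + p ≤ k := by
    by_contra hlt
    have : (2 : ℚ) ^ k ≤ (2 : ℚ) ^ (emin + p - 1) := zpow_le_zpow_right₀ (by norm_num) (by omega)
    rw [← hσk] at this
    exact absurd hσ (not_lt.mpr this)
  -- (8.5): `|τ₁| ≥ Φσ = 2^(M+3)eps·2ᵏ = 2^(k+M−p+3)`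
  have h85 : (2 : ℚ) ^ (k + Nat.clog 2 (xs.length + 2) - p + 3) ≤ |(hugeNTransform fl p emin xs).1| := by
    have h := H.exit hσ
    rw [hσk, two_pow_mul_u_mul_two_zpow] at h
    rwa [show k + Nat.clog 2 (xs.length + 2) - p + 3 = k + ((Nat.clog 2 (xs.length + 2) + 3 : ℕ) : ℤ) - p by
      push_cast; ring]
  -- `σ₀' = fl((2ᴹeps)σ) = 2^(k+M−p)` exactly, `log₂σ = k`, and `|q⁽⁰⁾ᵢ| ≤ eps σ = 2^((k+M−p) − M)`
  have hσ₀ : fl (2 ^ Nat.clog 2 (xs.length + 2) * unitRoundoff p * (2 : ℚ) ^ k) =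
      (2 : ℚ) ^ (k + Nat.clog 2 (xs.length + 2) - p) := by
    rw [two_pow_mul_u_mul_two_zpow]
    exact fl_eq_self hfl (isFloat_two_zpow hp (by omega))
  have hlog : Int.log 2 ((2 : ℚ) ^ k) = k := by
    have := Int.log_zpow (R := ℚ) (b := 2) (by norm_num) k
    exact_mod_cast this
  have hq₀ : ∀ x ∈ (hugeNTransform fl p emin xs).2.2.1,
      IsFloat p emin x ∧ |x| ≤ (2 : ℚ) ^ (k + Nat.clog 2 (xs.length + 2) - p - Nat.clog 2 (xs.length + 2)) := by
    intro x hx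
    obtain ⟨hxF, hxle⟩ := H.low x hx
    refine ⟨hxF, ?_⟩
    rwa [hσk, u_mul_two_zpow, show k - (p : ℤ) = k + Nat.clog 2 (xs.length + 2) - p - Nat.clog 2 (xs.length + 2)
      by ring] at hxle
  obtain ⟨hI, hsum, hlen⟩ := hugeNLoop_spec hp hfl hMp hnM |(hugeNTransform fl p emin xs).1|
    ((k - emin).toNat + 1) (k + Nat.clog 2 (xs.length + 2) - p) (hugeNTransform fl p emin xs).2.2.1
    (by omega) (by omega) H.length_eq hq₀
  refine ⟨k, hσk, hkp, ?_⟩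
  simp only [hugeNExtract]
  rw [hσk, hlog, hσ₀]
  exact ⟨hI, hsum, hlen, h85⟩

/-- **(8.14) for Algorithm 8.1**: under `2^(M+3)eps ≤ 1` the `repeat–until` loop is executed `K` times with
`K = 1` or `3K ≤ M` (see NOTES (a); printed: `K ≤ M/3`). [cite: RumpOgitaOishi2009, Proposition 8.2 (proof, eq. (8.14))] -/
theorem hugeNExtract_length (hfl : IsRoundNearest p emin fl) {xs : List ℚ}
    (hxs : ∀ x ∈ xs, IsFloat p emin x) (hne : maxAbs xs ≠ 0) (hM3 : Nat.clog 2 (xs.length + 2) + 3 ≤ p)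
    (hσ : (2 : ℚ) ^ (emin + p - 1) < (hugeNTransform fl p emin xs).2.2.2) :
    (hugeNExtract fl p emin xs).1.length = 1 ∨
      3 * (hugeNExtract fl p emin xs).1.length ≤ Nat.clog 2 (xs.length + 2) := by
  obtain ⟨k, -, -, hI, -, -, h85⟩ := hugeNExtract_spec hfl hxs hne hM3 hσ
  exact hI.three_mul_length_le h85 hM3

/-- **Eq. (8.19) / Table 8.1 for Algorithm 8.1**: if `(K + 1)M ≤ pK + 2` then at most `K` `repeat–until`
loops are executed ("Precisely `K` loops are needed if `M` is also larger than the maximum value for `K − 1`").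
[cite: RumpOgitaOishi2009, eq. (8.19) / Table 8.1] -/
theorem hugeNExtract_length_le_of (hfl : IsRoundNearest p emin fl) {xs : List ℚ}
    (hxs : ∀ x ∈ xs, IsFloat p emin x) (hne : maxAbs xs ≠ 0) (hM3 : Nat.clog 2 (xs.length + 2) + 3 ≤ p)
    (hσ : (2 : ℚ) ^ (emin + p - 1) < (hugeNTransform fl p emin xs).2.2.2) {K : ℕ} (hK : 1 ≤ K)
    (h819 : (K + 1) * Nat.clog 2 (xs.length + 2) ≤ p * K + 2) :
    (hugeNExtract fl p emin xs).1.length ≤ K := by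
  obtain ⟨k, -, -, hI, -, -, h85⟩ := hugeNExtract_spec hfl hxs hne hM3 hσ
  exact hI.length_le_of h85 (by omega) hK h819

/-! ### Proposition 8.2: the numerical facts behind (8.10)–(8.18) -/

/-- `eps ≤ 1/512` for `p ≥ 9`. [cite: RumpOgitaOishi2009, Proposition 8.2 ("eps ≤ 1/512")] -/
theorem u_le_inv_512 (hp9 : 9 ≤ p) : unitRoundoff p ≤ 1 / 512 := by
  have h : (2 : ℚ) ^ 9 ≤ 2 ^ p := pow_le_pow_right₀ (by norm_num) hp9
  calc unitRoundoff p = 1 / 2 ^ p := rfl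
    _ ≤ 1 / 2 ^ 9 := one_div_le_one_div_of_le (by norm_num) h
    _ = 1 / 512 := by norm_num

/-- `512m ≤ 9·2ᵐ` for `m ≥ 9` (so that `K eps ≤ (p/3)2⁻ᵖ ≤ 3/512`). [cite: RumpOgitaOishi2009, Proposition 8.2 (proof, eq. (8.15))] -/
theorem nat_mul_le_two_pow {m : ℕ} (hm : 9 ≤ m) : 512 * m ≤ 9 * 2 ^ m := by
  induction m, hm using Nat.le_induction with
  | base => norm_num
  | succ n hn ih =>
      have h2 : 512 ≤ 2 ^ n :=
        calc 512 = 2 ^ 9 := by norm_num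
          _ ≤ 2 ^ n := Nat.pow_le_pow_right (by norm_num) hn
      have h3 : 2 ^ (n + 1) = 2 * 2 ^ n := by rw [pow_succ]; ring
      rw [h3]
      generalize 2 ^ n = t at *
      omega

/-- (8.15), the input: `K eps ≤ 3/512` for `3K ≤ p` and `eps ≤ 1/512` (printed: "`(1 + eps)^K ≤
1/(1 − K eps)`" with `K ≤ M/3`, `2^(M+3)eps ≤ 1`). [cite: RumpOgitaOishi2009, Proposition 8.2 (proof, eq. (8.15))] -/
theorem length_mul_u_le (hp9 : 9 ≤ p) {K : ℕ} (hK : 3 * K ≤ p) : (K : ℚ) * unitRoundoff p ≤ 3 / 512 := by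
  have h0 := nat_mul_le_two_pow hp9
  have h1' : 512 * K ≤ 3 * 2 ^ p := by
    generalize 2 ^ p = t at *
    omega
  have h1 : (512 : ℚ) * K ≤ 3 * 2 ^ p := by exact_mod_cast h1'
  have hu0 : 0 < unitRoundoff p := u_pos
  have h3 : 512 * ((K : ℚ) * unitRoundoff p) ≤ 3 := by
    calc 512 * ((K : ℚ) * unitRoundoff p) = (512 * K) * unitRoundoff p := by ring
      _ ≤ (3 * 2 ^ p) * unitRoundoff p := mul_le_mul_of_nonneg_right h1 hu0.le
      _ = 3 := by rw [mul_assoc, two_pow_mul_u, mul_one]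
  linarith

/-- Bernoulli's inequality in the form used for (8.15): `1 − K eps ≤ (1 − eps)^K` (`0 ≤ eps ≤ 1`).
[cite: RumpOgitaOishi2009, Proposition 8.2 (proof, eq. (8.15), "(1 + eps)^K ≤ 1/(1 − K eps)")] -/
theorem one_sub_mul_le_one_sub_pow {u : ℚ} (hu0 : 0 ≤ u) (hu1 : u ≤ 1) :
    ∀ K : ℕ, 1 - (K : ℚ) * u ≤ (1 - u) ^ K
  | 0 => by simp
  | K + 1 => by
      have IH := one_sub_mul_le_one_sub_pow hu0 hu1 K
      have h1 : (1 - (K : ℚ) * u) * (1 - u) ≤ (1 - u) ^ K * (1 - u) :=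
        mul_le_mul_of_nonneg_right IH (by linarith)
      rw [pow_succ]
      push_cast
      nlinarith [mul_nonneg (Nat.cast_nonneg K) (mul_nonneg hu0 hu0)]

/-- **Eq. (8.15)**, the growth factor: `(1 + eps)^K ≤ 1/(1 − K eps) ≤ 512/509` (Bernoulli:
`(1 + eps)^K (1 − K eps) ≤ (1 + eps)^K (1 − eps)^K = (1 − eps²)^K ≤ 1`).
[cite: RumpOgitaOishi2009, Proposition 8.2 (proof, eq. (8.15))] -/
theorem one_add_u_pow_le (hp9 : 9 ≤ p) {K : ℕ} (hK : 3 * K ≤ p) :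
    (1 + unitRoundoff p) ^ K ≤ 512 / 509 := by
  have hu0 : 0 < unitRoundoff p := u_pos
  have hu := u_le_inv_512 hp9
  have hKu := length_mul_u_le hp9 hK
  have hB : 1 - (K : ℚ) * unitRoundoff p ≤ (1 - unitRoundoff p) ^ K :=
    one_sub_mul_le_one_sub_pow hu0.le (by linarith) K
  have hprod : (1 + unitRoundoff p) ^ K * (1 - unitRoundoff p) ^ K ≤ 1 := by
    rw [← mul_pow]
    exact pow_le_one₀ (by nlinarith) (by nlinarith)
  have hpos : (0 : ℚ) ≤ (1 + unitRoundoff p) ^ K := pow_nonneg (by linarith) K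
  have h4 : (1 + unitRoundoff p) ^ K * (1 - (K : ℚ) * unitRoundoff p) ≤ 1 :=
    (mul_le_mul_of_nonneg_left hB hpos).trans hprod
  have h5 : (1 + unitRoundoff p) ^ K * (509 / 512) ≤ 1 :=
    (mul_le_mul_of_nonneg_left (by linarith) hpos).trans h4
  linarith

/-- The constants of (8.12)–(8.13) and (8.16)–(8.17): with `ϕ = 2ᴹeps ≤ 1/8` and `eps ≤ 1/512`,
`A := (1 + eps)/(1 − (1 + eps)ϕ)` solves `(1 + eps)(1 + Aϕ) = A` with `1 + eps ≤ A ≤ 147/128` ("`< 1.15`"),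
and `D := 1/(1 − ϕ)` solves `1 + ϕD = D` with `1 ≤ D ≤ 8/7` (`eps|τ₁'|/(1 − ϕ)`).
[cite: RumpOgitaOishi2009, Proposition 8.2 (proof, eqs. (8.12), (8.13))] -/
theorem nested_constants (hp9 : 9 ≤ p) {M : ℕ} (hM3 : M + 3 ≤ p) :
    ∃ A D : ℚ, (1 + unitRoundoff p) * (1 + A * (2 : ℚ) ^ ((M : ℤ) - p)) = A ∧ 1 + unitRoundoff p ≤ A ∧
      A ≤ 147 / 128 ∧ 1 + (2 : ℚ) ^ ((M : ℤ) - p) * D = D ∧ 1 ≤ D ∧ D ≤ 8 / 7 := by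
  have hu0 : 0 < unitRoundoff p := u_pos
  have hu := u_le_inv_512 hp9
  have hϕ0 : (0 : ℚ) < (2 : ℚ) ^ ((M : ℤ) - p) := two_zpow_pos _
  have hϕ : (2 : ℚ) ^ ((M : ℤ) - p) ≤ 1 / 8 := by
    calc (2 : ℚ) ^ ((M : ℤ) - p) ≤ (2 : ℚ) ^ (-3 : ℤ) := zpow_le_zpow_right₀ (by norm_num) (by omega)
      _ = 1 / 8 := by norm_num
  have hprod : (1 + unitRoundoff p) * (2 : ℚ) ^ ((M : ℤ) - p) ≤ 513 / 4096 := by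
    calc (1 + unitRoundoff p) * (2 : ℚ) ^ ((M : ℤ) - p) ≤ (513 / 512) * (1 / 8) :=
          mul_le_mul (by linarith) hϕ hϕ0.le (by norm_num)
      _ = 513 / 4096 := by norm_num
  have hden : (0 : ℚ) < 1 - (1 + unitRoundoff p) * (2 : ℚ) ^ ((M : ℤ) - p) := by linarith
  have hden' : 1 - (1 + unitRoundoff p) * (2 : ℚ) ^ ((M : ℤ) - p) ≠ 0 := hden.ne'
  have hden1 : (0 : ℚ) < 1 - (2 : ℚ) ^ ((M : ℤ) - p) := by linarith
  have hden1' : 1 - (2 : ℚ) ^ ((M : ℤ) - p) ≠ 0 := hden1.ne'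
  refine ⟨(1 + unitRoundoff p) / (1 - (1 + unitRoundoff p) * (2 : ℚ) ^ ((M : ℤ) - p)),
    1 / (1 - (2 : ℚ) ^ ((M : ℤ) - p)), ?_, ?_, ?_, ?_, ?_, ?_⟩
  · field_simp
    ring
  · rw [le_div_iff₀ hden]
    nlinarith [mul_pos (mul_pos (by linarith : (0 : ℚ) < 1 + unitRoundoff p)
      (by linarith : (0 : ℚ) < 1 + unitRoundoff p)) hϕ0]
  · rw [div_le_iff₀ hden]
    linarith
  · field_simp
    ring
  · rw [le_div_iff₀ hden1]
    linarith
  · rw [div_le_iff₀ hden1]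
    linarith

/-! ### Proposition 8.2: the nested sum, eqs. (8.10), (8.12), (8.13) -/

/-- **Eqs. (8.10), (8.12), (8.13).** For parts `τ_k', …, τ_K' ∈ F` with `|τ_i'| < σ_{i−1}' = ϕ^(i−k)2ʲ` (8.7)
and a start value `c ∈ F` with `|c| ≤ (1 + eps)(|τ₂| + σ_K')` (8.11), the nested sum
`N = fl(τ_k' + fl(… + fl(τ_K' + c)…))` satisfies `N ∈ F`, (8.12)-type `|N| ≤ A·2ʲ + (1 + eps)^(K−k+2)|τ₂|`
where `(1 + eps)(1 + Aϕ) = A` (printed: `|fl(τ₁' + …)| < 1.15σ + (1 + eps)^(K+1)|τ₂|`), and (8.10)/(8.13)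
`|N − (Σ τ_i' + c)| ≤ Σ|δ_i| ≤ eps·A·2ʲ·D + |τ₂|(1 + eps)²((1 + eps)^(K−k+1) − 1)` where `1 + ϕD = D` (each
`|δ_i| ≤ eps|fl(τ_i' + …)|`, Part I (2.18)). [cite: RumpOgitaOishi2009, Proposition 8.2 (proof, eqs. (8.10)–(8.13))] -/
theorem nestedFlSum_spec (hp : 1 ≤ p) (hfl : IsRoundNearest p emin fl) {M : ℕ} {A D T₂ c : ℚ}
    (hA : (1 + unitRoundoff p) * (1 + A * (2 : ℚ) ^ ((M : ℤ) - p)) = A) (hA1 : 1 + unitRoundoff p ≤ A)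
    (hD : 1 + (2 : ℚ) ^ ((M : ℤ) - p) * D = D) (hD1 : 1 ≤ D) (hT₂ : 0 ≤ T₂) (hcF : IsFloat p emin c) :
    ∀ (τs : List ℚ) (j : ℤ), HugeNTaus p emin M j τs →
      |c| ≤ (1 + unitRoundoff p) * (T₂ + (2 : ℚ) ^ (j + (τs.length : ℤ) * ((M : ℤ) - p))) →
      IsFloat p emin (nestedFlSum fl τs c) ∧
        |nestedFlSum fl τs c| ≤ A * (2 : ℚ) ^ j + (1 + unitRoundoff p) ^ (τs.length + 1) * T₂ ∧
        |nestedFlSum fl τs c - (τs.sum + c)| ≤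
          unitRoundoff p * A * (2 : ℚ) ^ j * D +
            T₂ * (1 + unitRoundoff p) ^ 2 * ((1 + unitRoundoff p) ^ τs.length - 1)
  | [], j, _, hc => by
      have hu0 : 0 < unitRoundoff p := u_pos
      have h2j := two_zpow_pos j
      have hA0 : 0 ≤ A := by linarith
      have hD0 : 0 ≤ D := by linarith
      simp only [List.length_nil, Nat.cast_zero, zero_mul, add_zero] at hc
      simp only [nestedFlSum, List.length_nil, List.sum_nil, zero_add, pow_one, pow_zero, sub_self,
        mul_zero, add_zero, abs_zero]
      have h1 := mul_le_mul_of_nonneg_right hA1 h2j.le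
      refine ⟨hcF, by nlinarith [hc, h1], ?_⟩
      exact mul_nonneg (mul_nonneg (mul_nonneg hu0.le hA0) h2j.le) hD0
  | τ :: rest, j, hτs, hc => by
      have hu0 : 0 < unitRoundoff p := u_pos
      have h2j := two_zpow_pos j
      have hϕ0 : (0 : ℚ) < (2 : ℚ) ^ ((M : ℤ) - p) := two_zpow_pos _
      have hA0 : 0 ≤ A := by linarith
      have hD0 : 0 ≤ D := by linarith
      have h1u : (0 : ℚ) ≤ 1 + unitRoundoff p := by linarith
      simp only [HugeNTaus] at hτs
      obtain ⟨⟨hτF, hτlt⟩, hrest⟩ := hτs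
      have hexp : j + (((τ :: rest).length : ℕ) : ℤ) * ((M : ℤ) - p) =
          (j + M - p) + ((rest.length : ℕ) : ℤ) * ((M : ℤ) - p) := by
        simp only [List.length_cons]; push_cast; ring
      rw [hexp] at hc
      obtain ⟨hNF, hNabs, hNerr⟩ := nestedFlSum_spec hp hfl hA hA1 hD hD1 hT₂ hcF rest (j + M - p) hrest hc
      have hB : (2 : ℚ) ^ (j + M - p) = (2 : ℚ) ^ ((M : ℤ) - p) * (2 : ℚ) ^ j := by
        rw [← zpow_add₀ (by norm_num : (2 : ℚ) ≠ 0)]; congr 1; ring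
      rw [hB] at hNabs hNerr
      set N' := nestedFlSum fl rest c with hN'
      -- the new rounding error `δ`: `|fl(τ + N') − (τ + N')| ≤ eps·ufp(τ + N') ≤ eps|fl(τ + N')|`
      have herr : |fl (τ + N') - (τ + N')| ≤ unitRoundoff p * |fl (τ + N')| :=
        (abs_fl_add_sub_le_u_ufp hp hfl hτF hNF).trans
          (mul_le_mul_of_nonneg_left ((ufp_add_le_ufp_fl_add hp hfl hτF hNF).trans (ufp_le_abs _)) hu0.le)
      -- `|fl(τ + N')| ≤ (1 + eps)|τ + N'| ≤ (1 + eps)(2ʲ + |N'|)`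
      have habs : |fl (τ + N')| ≤ (1 + unitRoundoff p) * ((2 : ℚ) ^ j + |N'|) := by
        have h1 : |fl (τ + N')| ≤ |τ + N'| + unitRoundoff p * |τ + N'| := by
          have e1 := (abs_fl_add_sub_le_u_ufp hp hfl hτF hNF).trans (u_mul_ufp_le_u_mul_abs (τ + N'))
          have e2 : |fl (τ + N')| ≤ |τ + N'| + |fl (τ + N') - (τ + N')| := by
            calc |fl (τ + N')| = |(τ + N') + (fl (τ + N') - (τ + N'))| := by ring_nf
              _ ≤ |τ + N'| + |fl (τ + N') - (τ + N')| := abs_add_le _ _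
          linarith
        have h2 : |τ + N'| ≤ (2 : ℚ) ^ j + |N'| := (abs_add_le _ _).trans (by linarith)
        have h3 := mul_le_mul_of_nonneg_left h2 hu0.le
        nlinarith [h1, h2, h3]
      simp only [nestedFlSum, List.length_cons, List.sum_cons]
      refine ⟨(hfl _).1, ?_, ?_⟩
      · -- (8.12): `(1 + eps)(2ʲ + A ϕ 2ʲ + (1 + eps)^(L+1) T₂) = A 2ʲ + (1 + eps)^(L+2) T₂`
        have key : (1 + unitRoundoff p) * ((2 : ℚ) ^ j + (A * ((2 : ℚ) ^ ((M : ℤ) - p) * (2 : ℚ) ^ j) +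
            (1 + unitRoundoff p) ^ (rest.length + 1) * T₂)) =
            A * (2 : ℚ) ^ j + (1 + unitRoundoff p) ^ (rest.length + 1 + 1) * T₂ := by
          have : A * (2 : ℚ) ^ j = (1 + unitRoundoff p) * (1 + A * (2 : ℚ) ^ ((M : ℤ) - p)) * (2 : ℚ) ^ j := by
            rw [hA]
          rw [this]; ring
        have h4 := mul_le_mul_of_nonneg_left (add_le_add_left hNabs ((2 : ℚ) ^ j)) h1u
        linarith [habs, h4, key]
      · -- (8.10)/(8.13): `|δ| + previous errors`
        have hsplit : fl (τ + N') - (τ + rest.sum + c) = (fl (τ + N') - (τ + N')) + (N' - (rest.sum + c)) := by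
          ring
        rw [hsplit]
        refine (abs_add_le _ _).trans ?_
        -- `|δ| ≤ eps|fl(τ + N')| ≤ eps(A 2ʲ + (1 + eps)^(L+2) T₂)`
        have key : (1 + unitRoundoff p) * ((2 : ℚ) ^ j + (A * ((2 : ℚ) ^ ((M : ℤ) - p) * (2 : ℚ) ^ j) +
            (1 + unitRoundoff p) ^ (rest.length + 1) * T₂)) =
            A * (2 : ℚ) ^ j + (1 + unitRoundoff p) ^ (rest.length + 1 + 1) * T₂ := by
          have : A * (2 : ℚ) ^ j = (1 + unitRoundoff p) * (1 + A * (2 : ℚ) ^ ((M : ℤ) - p)) * (2 : ℚ) ^ j := by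
            rw [hA]
          rw [this]; ring
        have h4 := mul_le_mul_of_nonneg_left (add_le_add_left hNabs ((2 : ℚ) ^ j)) h1u
        have h5 : |fl (τ + N')| ≤ A * (2 : ℚ) ^ j + (1 + unitRoundoff p) ^ (rest.length + 1 + 1) * T₂ := by
          linarith [habs, h4, key]
        have h6 := mul_le_mul_of_nonneg_left h5 hu0.le
        -- `eps A 2ʲ + eps A ϕ 2ʲ D = eps A 2ʲ D`
        have keyD : unitRoundoff p * (A * (2 : ℚ) ^ j) +
            unitRoundoff p * A * ((2 : ℚ) ^ ((M : ℤ) - p) * (2 : ℚ) ^ j) * D =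
            unitRoundoff p * A * (2 : ℚ) ^ j * D := by
          have : unitRoundoff p * A * (2 : ℚ) ^ j * D =
              unitRoundoff p * A * (2 : ℚ) ^ j * (1 + (2 : ℚ) ^ ((M : ℤ) - p) * D) := by rw [hD]
          rw [this]; ring
        -- `eps(1 + eps)^(L+2) T₂ + T₂(1 + eps)²((1 + eps)^L − 1) = T₂(1 + eps)²((1 + eps)^(L+1) − 1)`
        have keyT : unitRoundoff p * ((1 + unitRoundoff p) ^ (rest.length + 1 + 1) * T₂) +
            T₂ * (1 + unitRoundoff p) ^ 2 * ((1 + unitRoundoff p) ^ rest.length - 1) =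
            T₂ * (1 + unitRoundoff p) ^ 2 * ((1 + unitRoundoff p) ^ (rest.length + 1) - 1) := by
          ring
        linarith [herr, h6, hNerr, keyD, keyT]

/-! ### Proposition 8.2: the analysis (8.1)–(8.18) -/

/-- **(8.8)–(8.11): the last part `τ_{K+1}' = fl(τ₂ + float(Σ q⁽ᴷ⁾ᵢ))`.** After the loop,
`|q⁽ᴷ⁾ᵢ| ≤ eps σ_{K−1}'` with `σ_{K−1}' = 2^jL`, `σ_K' = ϕσ_{K−1}' = 2ᴸ`. If `σ_{K−1}' ≤ ½eps⁻¹eta` then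
`q⁽ᴷ⁾ = 0` and `τ_{K+1}' = τ₂`; otherwise (8.8) `|Σ q⁽ᴷ⁾ᵢ| ≤ n eps σ_{K−1}' < σ_K'` and
`|float(Σ q⁽ᴷ⁾ᵢ)| ≤ n eps σ_{K−1}'`, Part I (2.20) `|float(Σ q⁽ᴷ⁾ᵢ) − Σ q⁽ᴷ⁾ᵢ| ≤ ½n(n−1)eps·eps σ_{K−1}'`, the
`until` condition `2^(2M+1)eps σ_{K−1}' ≤ |τ₁|` and `½n(n+1) ≤ ½(n+2)² ≤ ½2^(2M)` give (8.9)–(8.10)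
`|τ₂ + Σ q⁽ᴷ⁾ᵢ − τ_{K+1}'| ≤ eps(|τ₂| + ¼|τ₁|)` and (8.11) `|τ_{K+1}'| ≤ (1 + eps)(|τ₂| + σ_K')`.
[cite: RumpOgitaOishi2009, Proposition 8.2 (proof, eqs. (8.8)–(8.11))] -/
theorem lastPart_spec (hp : 1 ≤ p) (hfl : IsRoundNearest p emin fl) {M : ℕ} (hMp : M < p) {n : ℕ}
    (hn : 1 ≤ n) (hnM : n + 2 ≤ 2 ^ M) {τ₁ τ₂ : ℚ} (hτ₂F : IsFloat p emin τ₂) {qK : List ℚ}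
    (hlenK : qK.length = n) {jL L : ℤ} (hL : jL + M - p = L)
    (hqK : ∀ x ∈ qK, IsFloat p emin x ∧ |x| ≤ unitRoundoff p * (2 : ℚ) ^ jL)
    (hexit : (2 : ℚ) ^ jL ≤ (2 : ℚ) ^ (emin + p - 1) ∨
      ((2 : ℚ) ^ (emin + p - 1) < (2 : ℚ) ^ jL ∧ 2 ^ (2 * M + 1) * unitRoundoff p * (2 : ℚ) ^ jL ≤ |τ₁|)) :
    IsFloat p emin (flSum fl qK) ∧
      |fl (τ₂ + flSum fl qK)| ≤ (1 + unitRoundoff p) * (|τ₂| + (2 : ℚ) ^ L) ∧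
      |τ₂ + qK.sum - fl (τ₂ + flSum fl qK)| ≤ unitRoundoff p * (|τ₂| + |τ₁| / 4) := by
  have hu0 : 0 < unitRoundoff p := u_pos
  have hqKne : qK ≠ [] := by
    intro h; rw [h] at hlenK; simp at hlenK; omega
  rcases hexit with hle | ⟨hgt, huntil⟩
  · -- `σ_{K−1}' ≤ ½eps⁻¹eta`: `|q⁽ᴷ⁾ᵢ| ≤ eps σ_{K−1}' < eta` forces `q⁽ᴷ⁾ = 0`, `τ_{K+1}' = τ₂`
    have hqz : ∀ x ∈ qK, x = 0 := by
      intro x hx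
      obtain ⟨hxF, hxle⟩ := hqK x hx
      refine eq_zero_of_isFloat_of_abs_lt hxF (hxle.trans_lt ?_)
      calc unitRoundoff p * (2 : ℚ) ^ jL ≤ unitRoundoff p * (2 : ℚ) ^ (emin + p - 1) :=
            mul_le_mul_of_nonneg_left hle hu0.le
        _ = (2 : ℚ) ^ (emin - 1) := by rw [u_mul_two_zpow]; congr 1; ring
        _ < (2 : ℚ) ^ emin := zpow_lt_zpow_right₀ (by norm_num) (by omega)
    have hQ0 : flSum fl qK = 0 := flSum_eq_zero hfl hqz
    have hsum0 : qK.sum = 0 := List.sum_eq_zero hqz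
    have hc : fl (τ₂ + flSum fl qK) = τ₂ := by rw [hQ0, add_zero, fl_eq_self hfl hτ₂F]
    refine ⟨by rw [hQ0]; exact isFloat_zero p emin, ?_, ?_⟩
    · rw [hc]
      have h1 : (0 : ℚ) ≤ (2 : ℚ) ^ L := (two_zpow_pos _).le
      have h2 : |τ₂| ≤ |τ₂| + (2 : ℚ) ^ L := by linarith
      exact h2.trans (le_mul_of_one_le_left (by positivity) (by linarith))
    · rw [hc, hsum0, add_zero, sub_self, abs_zero]
      exact mul_nonneg hu0.le (by positivity)
  · -- `σ_{K−1}' = 2^jL > ½eps⁻¹eta`: tree bounds for `float(Σ q⁽ᴷ⁾ᵢ)`, `|q⁽ᴷ⁾ᵢ| ≤ eps σ_{K−1}' = 2^(jL−p)`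
    have hjLp : emin + p ≤ jL := by
      by_contra hlt
      have : (2 : ℚ) ^ jL ≤ (2 : ℚ) ^ (emin + p - 1) := zpow_le_zpow_right₀ (by norm_num) (by omega)
      exact absurd hgt (not_lt.mpr this)
    have hj : emin ≤ jL - p := by omega
    obtain ⟨tr, htr, hft⟩ := exists_tree_flSum fl hqKne
    have hleaves : ∀ a ∈ tr.leaves, IsFloat p emin a ∧ |a| ≤ (2 : ℚ) ^ (jL - p) := by
      intro a ha
      obtain ⟨haF, hale⟩ := hqK a (htr ▸ ha)
      exact ⟨haF, by rwa [u_mul_two_zpow] at hale⟩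
    have hlen : tr.leaves.length = n := by rw [htr, hlenK]
    have hnp : tr.leaves.length ≤ 2 ^ p := by
      rw [hlen]; exact le_trans (by omega) (Nat.pow_le_pow_right (by norm_num) hMp.le)
    have hQF : IsFloat p emin (flSum fl qK) := by
      rw [hft]; exact isFloat_eval hfl tr (fun a ha => (hleaves a ha).1)
    -- (8.8): `|float(Σ q⁽ᴷ⁾ᵢ)| ≤ n·2^(jL−p)`; Part I (2.20): `|float(Σ q⁽ᴷ⁾ᵢ) − Σ q⁽ᴷ⁾ᵢ| ≤ ½n(n−1)eps·2^(jL−p)`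
    have hQabs : |flSum fl qK| ≤ n * (2 : ℚ) ^ (jL - p) := by
      have := abs_eval_le_length_mul hp hfl hj tr hleaves hnp
      rw [hlen] at this; rw [hft]; exact this
    have hQerr : |flSum fl qK - qK.sum| ≤
        ((n : ℚ) * ((n : ℚ) - 1) / 2) * (unitRoundoff p * (2 : ℚ) ^ (jL - p)) := by
      have := abs_eval_sub_exact_le hp hfl hj tr hleaves hnp
      rw [hlen, exact_eq_leaves_sum, htr] at this; rw [hft]; exact this
    have hcerr : |fl (τ₂ + flSum fl qK) - (τ₂ + flSum fl qK)| ≤ unitRoundoff p * (|τ₂| + |flSum fl qK|) :=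
      (abs_fl_add_sub_le_u_ufp hp hfl hτ₂F hQF).trans
        (mul_le_mul_of_nonneg_left ((ufp_le_abs _).trans (abs_add_le _ _)) hu0.le)
    have hW0 : (0 : ℚ) < (2 : ℚ) ^ (jL - p) := two_zpow_pos _
    -- `n·2^(jL−p) ≤ 2ᴹeps σ_{K−1}' = σ_K' = 2ᴸ`
    have hnW : (n : ℚ) * (2 : ℚ) ^ (jL - p) ≤ (2 : ℚ) ^ L := by
      have hn2M : (n : ℚ) ≤ (2 : ℚ) ^ M := by exact_mod_cast (show n ≤ 2 ^ M by omega)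
      calc (n : ℚ) * (2 : ℚ) ^ (jL - p) ≤ 2 ^ M * (2 : ℚ) ^ (jL - p) :=
            mul_le_mul_of_nonneg_right hn2M hW0.le
        _ = (2 : ℚ) ^ L := by
            rw [← zpow_natCast, ← zpow_add₀ (by norm_num : (2 : ℚ) ≠ 0), ← hL]
            congr 1; ring
    -- the `until` condition: `2^(2M+1)eps σ_{K−1}' = 2·2^(2M)·2^(jL−p) ≤ |τ₁|`
    have huntil' : 2 * (2 : ℚ) ^ (2 * M) * (2 : ℚ) ^ (jL - p) ≤ |τ₁| := by
      have : (2 : ℚ) ^ (2 * M + 1) * unitRoundoff p * (2 : ℚ) ^ jL =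
          2 * (2 : ℚ) ^ (2 * M) * (2 : ℚ) ^ (jL - p) := by
        rw [mul_assoc, u_mul_two_zpow, pow_succ]; ring
      rwa [this] at huntil
    -- `n + ½n(n−1) = ½n(n+1) ≤ ½(n+2)² ≤ ½·2^(2M)`
    have hnn : (n : ℚ) * ((n : ℚ) - 1) / 2 + n ≤ (2 : ℚ) ^ (2 * M) / 2 := by
      have h1 : ((n : ℚ) + 2) ≤ (2 : ℚ) ^ M := by exact_mod_cast hnM
      have h2 : ((n : ℚ) + 2) ^ 2 ≤ ((2 : ℚ) ^ M) ^ 2 := pow_le_pow_left₀ (by positivity) h1 2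
      rw [← pow_mul, show M * 2 = 2 * M by ring] at h2
      have h3 : (0 : ℚ) ≤ n := by positivity
      nlinarith [h2, h3]
    refine ⟨hQF, ?_, ?_⟩
    · -- (8.11): `|τ_{K+1}'| ≤ (1 + eps)(|τ₂| + σ_K')`
      have e2 : |fl (τ₂ + flSum fl qK)| ≤
          |τ₂ + flSum fl qK| + |fl (τ₂ + flSum fl qK) - (τ₂ + flSum fl qK)| := by
        have := abs_add_le (τ₂ + flSum fl qK) (fl (τ₂ + flSum fl qK) - (τ₂ + flSum fl qK))
        rwa [add_sub_cancel] at this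
      have e3 := abs_add_le τ₂ (flSum fl qK)
      have h1 : |fl (τ₂ + flSum fl qK)| ≤ (1 + unitRoundoff p) * (|τ₂| + |flSum fl qK|) := by
        linarith [hcerr]
      have h1u : (0 : ℚ) ≤ 1 + unitRoundoff p := by linarith
      have h2 : (1 + unitRoundoff p) * (|τ₂| + |flSum fl qK|) ≤ (1 + unitRoundoff p) * (|τ₂| + (2 : ℚ) ^ L) :=
        mul_le_mul_of_nonneg_left (by linarith [hQabs.trans hnW]) h1u
      exact h1.trans h2
    · -- (8.9)–(8.10): `|δ_{K+1}| ≤ eps(|τ₂| + |float(Σ q⁽ᴷ⁾)|) + ½n(n−1)eps·2^(jL−p) ≤ eps(|τ₂| + ¼|τ₁|)`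
      have hsplit : τ₂ + qK.sum - fl (τ₂ + flSum fl qK) =
          -(fl (τ₂ + flSum fl qK) - (τ₂ + flSum fl qK)) + -(flSum fl qK - qK.sum) := by ring
      have h1 : |τ₂ + qK.sum - fl (τ₂ + flSum fl qK)| ≤ unitRoundoff p * (|τ₂| + |flSum fl qK|) +
          ((n : ℚ) * ((n : ℚ) - 1) / 2) * (unitRoundoff p * (2 : ℚ) ^ (jL - p)) := by
        rw [hsplit]
        refine (abs_add_le _ _).trans ?_
        rw [abs_neg, abs_neg]
        exact add_le_add hcerr hQerr
      have h2 := mul_le_mul_of_nonneg_left hQabs hu0.le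
      have h3 : ((n : ℚ) * ((n : ℚ) - 1) / 2 + n) * (2 : ℚ) ^ (jL - p) ≤ |τ₁| / 4 := by
        have := mul_le_mul_of_nonneg_right hnn hW0.le
        linarith [huntil']
      have h4 := mul_le_mul_of_nonneg_left h3 hu0.le
      linarith [h1, h2, h3, h4]

/-- The second "without loss of generality" of the proof, eq. (8.6): if `|τ₁| < eps⁻¹eta` then, by (8.5)
`8σ₀' ≤ |τ₁|`, already `σ₀' ≤ ½eps⁻¹eta`: the loop stops after one pass, `|q⁽¹⁾ᵢ| ≤ eps σ₀' < eta` and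
`|τ₂| ≤ eps|τ₁| < eta` force `q⁽¹⁾ = 0`, `τ₂ = 0`, so `τ₂' = fl(τ₂ + 0) = 0`, `s = τ₁ + τ₁'` and
`res = fl(τ₁ + τ₁') = fl(s)` is even a nearest rounding. [cite: RumpOgitaOishi2009, Proposition 8.2 (proof, eq. (8.6))] -/
theorem faithful_of_hugeNInv_small (hfl : IsRoundNearest p emin fl) {M : ℕ} {τ₁ τ₂ s : ℚ} {j : ℤ}
    {τs qK : List ℚ} (hτ₂F : IsFloat p emin τ₂) (hT₂le : |τ₂| ≤ unitRoundoff p * |τ₁|)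
    (hI : HugeNInv p emin M |τ₁| qK j τs) (h85 : (2 : ℚ) ^ (j + 3) ≤ |τ₁|)
    (hsmall : |τ₁| < (2 : ℚ) ^ (emin + p)) (hs : s = τ₁ + τ₂ + τs.sum + qK.sum) :
    IsFaithfulRounding p emin (fl (τ₁ + nestedFlSum fl τs (fl (τ₂ + flSum fl qK)))) s := by
  have hu0 : 0 < unitRoundoff p := u_pos
  have hj₀ : j + 3 < emin + p :=
    (zpow_lt_zpow_iff_right₀ (by norm_num : (1 : ℚ) < 2)).mp (h85.trans_lt hsmall)
  rcases τs with _ | ⟨τ', _ | ⟨τ'', rest⟩⟩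
  · exact (hI.ne_nil rfl).elim
  · obtain ⟨hτ'F, -, hqK, -⟩ := hI.of_single
    have hqz : ∀ x ∈ qK, x = 0 := by
      intro x hx
      obtain ⟨hxF, hxle⟩ := hqK x hx
      refine eq_zero_of_isFloat_of_abs_lt hxF (hxle.trans_lt ?_)
      rw [u_mul_two_zpow]
      exact zpow_lt_zpow_right₀ (by norm_num) (by omega)
    have hτ₂z : τ₂ = 0 := by
      refine eq_zero_of_isFloat_of_abs_lt hτ₂F (hT₂le.trans_lt ?_)
      calc unitRoundoff p * |τ₁| < unitRoundoff p * (2 : ℚ) ^ (emin + p) := mul_lt_mul_of_pos_left hsmall hu0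
        _ = (2 : ℚ) ^ emin := by rw [u_mul_two_zpow]; congr 1; ring
    have hQ : flSum fl qK = 0 := flSum_eq_zero hfl hqz
    have hsumK : qK.sum = 0 := List.sum_eq_zero hqz
    have hc : fl (τ₂ + flSum fl qK) = 0 := by
      rw [hQ, hτ₂z, add_zero, fl_eq_self hfl (isFloat_zero p emin)]
    have hN : nestedFlSum fl [τ'] (fl (τ₂ + flSum fl qK)) = τ' := by
      simp only [nestedFlSum]
      rw [hc, add_zero, fl_eq_self hfl hτ'F]
    rw [hN, hs, hτ₂z, hsumK]
    simp only [List.sum_cons, List.sum_nil, add_zero]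
    exact isFaithfulRounding_fl hfl _
  · have h1 := (hI.lt_two_pow).1
    have : emin + p - 1 < j := (zpow_lt_zpow_iff_right₀ (by norm_num : (1 : ℚ) < 2)).mp h1
    omega

/-- **The numerical constants of (8.12)–(8.18).** With `T = |τ₁| ≥ 8σ₀'` (`B = σ₀'`, (8.5)),
`T₂ = |τ₂| ≤ eps T` (8.3), `A ≤ 147/128` ("`1.15`", (8.12)), `D ≤ 8/7` (`1/(1 − ϕ)`, (8.13)),
`G = (1 + eps)^K ≤ 512/509` (8.15) and `eps ≤ 1/512`: (8.16) `|fl(τ₁' + …)| ≤ A σ₀' + (1 + eps)^(K+1)|τ₂|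
≤ (147/1024 + 513/509·eps) T`, and (8.18) `Σ|δ_k| + |δ_{K+1}| ≤ eps·A·D·σ₀' + |τ₂|(1+eps)²((1+eps)^K − 1) +
eps(|τ₂| + ¼T) ≤ (84 + 4 + 1 + 128)/512 · eps T = 217/512 · eps T`.
[cite: RumpOgitaOishi2009, Proposition 8.2 (proof, eqs. (8.15)–(8.18))] -/
theorem prop82_numerics {u T T₂ A B D G N E₁ E₂ : ℚ} (hu0 : 0 < u) (hu : u ≤ 1 / 512)
    (hB0 : 0 ≤ B) (h85 : 8 * B ≤ T) (hT₂0 : 0 ≤ T₂) (hT₂ : T₂ ≤ u * T)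
    (hAle : A ≤ 147 / 128) (hD1 : 1 ≤ D) (hDle : D ≤ 8 / 7) (hG1 : 1 ≤ G)
    (hG : G ≤ 512 / 509) (hN : N ≤ A * B + G * (1 + u) * T₂)
    (hE₁ : E₁ ≤ u * A * B * D + T₂ * (1 + u) ^ 2 * (G - 1)) (hE₂ : E₂ ≤ u * (T₂ + T / 4)) :
    N ≤ 147 / 1024 * T + 513 / 509 * (u * T) ∧ E₁ + E₂ ≤ u * T * (217 / 512) := by
  have hT0 : 0 ≤ T := by linarith
  have hUT0 : 0 ≤ u * T := mul_nonneg hu0.le hT0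
  have P1 : A * B ≤ 147 / 128 * (T / 8) := mul_le_mul hAle (by linarith) hB0 (by norm_num)
  have P2 : G * (1 + u) * T₂ ≤ 513 / 509 * (u * T) := by
    have h1 : G * (1 + u) ≤ 512 / 509 * (513 / 512) := mul_le_mul hG (by linarith) (by linarith) (by norm_num)
    exact mul_le_mul (by linarith) hT₂ hT₂0 (by norm_num)
  have P3 : u * A * B * D ≤ u * (147 / 128 * (T / 8) * (8 / 7)) := by
    have h1 : A * B * D ≤ 147 / 128 * (T / 8) * (8 / 7) := mul_le_mul P1 hDle (by linarith) (by linarith)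
    have h2 := mul_le_mul_of_nonneg_left h1 hu0.le
    calc u * A * B * D = u * (A * B * D) := by ring
      _ ≤ u * (147 / 128 * (T / 8) * (8 / 7)) := h2
  have P4 : T₂ * (1 + u) ^ 2 * (G - 1) ≤ (u * T) * ((513 / 512) ^ 2 * (3 / 509)) := by
    have h1 : (1 + u) ^ 2 ≤ (513 / 512) ^ 2 := pow_le_pow_left₀ (by linarith) (by linarith) 2
    have h2 : G - 1 ≤ 3 / 509 := by linarith
    have h3 : (1 + u) ^ 2 * (G - 1) ≤ (513 / 512) ^ 2 * (3 / 509) :=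
      mul_le_mul h1 h2 (by linarith) (by positivity)
    calc T₂ * (1 + u) ^ 2 * (G - 1) = T₂ * ((1 + u) ^ 2 * (G - 1)) := by ring
      _ ≤ (u * T) * ((513 / 512) ^ 2 * (3 / 509)) :=
        mul_le_mul hT₂ h3 (mul_nonneg (by positivity) (by linarith)) hUT0
  have P5 : u * T₂ ≤ u * T * (1 / 512) := by
    calc u * T₂ ≤ u * (u * T) := mul_le_mul_of_nonneg_left hT₂ hu0.le
      _ = (u * T) * u := by ring
      _ ≤ (u * T) * (1 / 512) := mul_le_mul_of_nonneg_left hu hUT0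
  constructor
  · linarith [P1, P2]
  · have e2 : u * (T₂ + T / 4) = u * T₂ + u * T / 4 := by ring
    linarith [P3, P4, P5, e2]

/-- **(8.16)–(8.18) and Part I, Lemma 2.5.** For `τ₁ ∈ F` with `|τ₁| ≥ eps⁻¹eta` (8.6), `N = fl(τ₁' + …) ∈ F`
with `|N| ≤ (147/1024 + 513/509·eps)|τ₁|` and `|s − (τ₁ + N)| = |δ| ≤ 217/512·eps|τ₁|`, the result
`res = fl(τ₁ + N)` satisfies `|res| ≥ (1 − eps)(|τ₁| − |N|) > 217/256·|τ₁| ≥ ½eps⁻¹eta` (printed: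
`> 0.847|τ₁|`) and `2|δ| < eps|res|`, so `res ∉ U` and Lemma 2.5 of Part I shows that `res` is a faithful
rounding of `τ₁ + N + δ = s`. [cite: RumpOgitaOishi2009, Proposition 8.2 (proof, eqs. (8.16)–(8.18))] -/
theorem faithful_res_of_bounds (hp : 1 ≤ p) (hfl : IsRoundNearest p emin fl) (hu : unitRoundoff p ≤ 1 / 512)
    {τ₁ N s : ℚ} (hτ₁F : IsFloat p emin τ₁) (hNF : IsFloat p emin N)
    (hbig : (2 : ℚ) ^ (emin + p) ≤ |τ₁|)
    (hN : |N| ≤ 147 / 1024 * |τ₁| + 513 / 509 * (unitRoundoff p * |τ₁|))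
    (hδ : |s - (τ₁ + N)| ≤ unitRoundoff p * |τ₁| * (217 / 512)) :
    IsFaithfulRounding p emin (fl (τ₁ + N)) s := by
  have hu0 : 0 < unitRoundoff p := u_pos
  have hT0 : 0 < |τ₁| := lt_of_lt_of_le (two_zpow_pos _) hbig
  -- `|res − (τ₁ + N)| ≤ eps|τ₁ + N|`, hence `|res| ≥ (1 − eps)|τ₁ + N| ≥ (1 − eps)(|τ₁| − |N|)`
  have hres_err : |fl (τ₁ + N) - (τ₁ + N)| ≤ unitRoundoff p * |τ₁ + N| :=
    (abs_fl_add_sub_le_u_ufp hp hfl hτ₁F hNF).trans (u_mul_ufp_le_u_mul_abs _)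
  have hres_ge : (1 - unitRoundoff p) * (|τ₁| - |N|) ≤ |fl (τ₁ + N)| := by
    have h1 : |τ₁| - |N| ≤ |τ₁ + N| := by
      have := abs_add_le (τ₁ + N) (-N)
      rw [add_neg_cancel_right, abs_neg] at this
      linarith
    have h2 : |τ₁ + N| - unitRoundoff p * |τ₁ + N| ≤ |fl (τ₁ + N)| := by
      have := abs_sub_abs_le_abs_sub (τ₁ + N) (fl (τ₁ + N))
      rw [abs_sub_comm] at this
      linarith [hres_err]
    have h3 : (1 - unitRoundoff p) * (|τ₁| - |N|) ≤ (1 - unitRoundoff p) * |τ₁ + N| :=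
      mul_le_mul_of_nonneg_left h1 (by linarith)
    linarith
  -- (8.16)/(8.17): `|res| > 217/256·|τ₁|`
  have hres' : 217 / 256 * |τ₁| < |fl (τ₁ + N)| := by
    have hu' : unitRoundoff p * |τ₁| ≤ (1 / 512) * |τ₁| := mul_le_mul_of_nonneg_right hu (abs_nonneg _)
    have hX : (877 / 1024 - 513 / 509 * (1 / 512)) * |τ₁| ≤ |τ₁| - |N| := by linarith [hN, hu']
    have hX0 : 0 ≤ (877 / 1024 - 513 / 509 * (1 / 512)) * |τ₁| := mul_nonneg (by norm_num) (abs_nonneg _)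
    have h1u : (511 : ℚ) / 512 ≤ 1 - unitRoundoff p := by linarith
    have h2 := mul_le_mul h1u hX hX0 (by linarith)
    linarith [hres_ge, h2, hT0]
  -- Part I, Lemma 2.5: `|res| > ½eps⁻¹eta` and `2|δ| < eps|res|`
  have hU : (2 : ℚ) ^ (emin + p - 1) < |fl (τ₁ + N)| := by
    have h2 : (2 : ℚ) ^ (emin + p) = 2 * (2 : ℚ) ^ (emin + p - 1) := by
      rw [mul_comm, ← zpow_add_one₀ (by norm_num : (2 : ℚ) ≠ 0), sub_add_cancel]
    have := two_zpow_pos (emin + p - 1)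
    rw [h2] at hbig
    linarith [hbig, hres']
  have hδ2 : 2 * |s - (τ₁ + N)| < unitRoundoff p * |fl (τ₁ + N)| := by
    have := mul_lt_mul_of_pos_left hres' hu0
    have h0 : 0 ≤ unitRoundoff p * |τ₁| := mul_nonneg hu0.le (abs_nonneg _)
    linarith [hδ, this]
  have key := isFaithfulRounding_fl_of_not_mem_U hp hfl hU hδ2
  have heq : τ₁ + N + (s - (τ₁ + N)) = s := by ring
  rwa [heq] at key

/-- **PROPOSITION 8.2, the analysis.** From the results `[τ₁, τ₂, q⁽⁰⁾, σ]` of `Transform` with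
`Φ = 2^(M+3)eps` (Lemma 3.4: (8.1) `s = τ₁ + τ₂ + Σ q⁽⁰⁾`, (8.3) `|τ₂| ≤ eps|τ₁|`, (8.5) `|τ₁| ≥ Φσ`) for
`σ = 2ᵏ > ½eps⁻¹eta`, and the loop state (8.7) with `Σ q⁽⁰⁾ = Σ τ_k' + Σ q⁽ᴷ⁾`, the result
`res = fl(τ₁ + fl(τ₁' + … + fl(τ_K' + τ_{K+1}')…))`, `τ_{K+1}' = fl(τ₂ + float(Σ q⁽ᴷ⁾ᵢ))`, is a faithful
rounding of `s`, provided `2^(M+3)eps ≤ 1` and `eps ≤ 1/512`: (8.8)–(8.11) `lastPart_spec`; (8.12)–(8.13)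
`nestedFlSum_spec` with the constants of `nested_constants`; (8.14)–(8.15) `3K ≤ p`, `(1 + eps)^K ≤ 512/509`;
(8.16)–(8.18) `prop82_numerics` and `faithful_res_of_bounds`. The case `|τ₁| < eps⁻¹eta` excluded by (8.6)
is `faithful_of_hugeNInv_small`. [cite: RumpOgitaOishi2009, Proposition 8.2 (proof)] -/
theorem faithful_of_hugeNInv (hfl : IsRoundNearest p emin fl) (hp9 : 9 ≤ p) {M : ℕ} (hM3 : M + 3 ≤ p)
    {n : ℕ} (hn : 1 ≤ n) (hnM : n + 2 ≤ 2 ^ M) {s τ₁ τ₂ σ : ℚ} {q₀ : List ℚ}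
    (H : TransformPhiSpec p emin fl M (2 ^ (M + 3) * unitRoundoff p) s n τ₁ τ₂ q₀ σ)
    (hσ : (2 : ℚ) ^ (emin + p - 1) < σ) {k : ℤ} (hσk : σ = (2 : ℚ) ^ k) {τs qK : List ℚ}
    (hI : HugeNInv p emin M |τ₁| qK (k + M - p) τs) (hsum : q₀.sum = τs.sum + qK.sum)
    (hlenK : qK.length = n) :
    IsFaithfulRounding p emin (fl (τ₁ + nestedFlSum fl τs (fl (τ₂ + flSum fl qK)))) s := by
  have hp : 1 ≤ p := by omega
  have hMp : M < p := by omega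
  have hu0 : 0 < unitRoundoff p := u_pos
  have hu := u_le_inv_512 hp9
  have hτ₁F := H.isFloat₁
  have hτ₂F := H.isFloat₂
  obtain ⟨t, τ, -, -, -, -, -, -, hs, h12, -, hτ₂le⟩ := H.last
  -- (8.1): `s = τ₁ + τ₂ + Σ q⁽⁰⁾ = τ₁ + τ₂ + Σ τ_k' + Σ q⁽ᴷ⁾`
  have hs' : s = τ₁ + τ₂ + τs.sum + qK.sum := by rw [hs, ← h12, hsum]; ring
  -- (8.3): `|τ₂| ≤ eps·ufp(τ₁) ≤ eps|τ₁|`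
  have hT₂le : |τ₂| ≤ unitRoundoff p * |τ₁| := hτ₂le.trans (u_mul_ufp_le_u_mul_abs τ₁)
  have hB0 : (0 : ℚ) < (2 : ℚ) ^ (k + M - p) := two_zpow_pos _
  -- (8.5): `|τ₁| ≥ Φσ = 8ϕσ = 8σ₀'`, `σ₀' = 2^(k+M−p)`
  have h85' : (2 : ℚ) ^ (k + M - p + 3) ≤ |τ₁| := by
    have h := H.exit hσ
    rw [hσk, two_pow_mul_u_mul_two_zpow] at h
    rwa [show k + (M : ℤ) - p + 3 = k + ((M + 3 : ℕ) : ℤ) - p by push_cast; ring]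
  have h85 : 8 * (2 : ℚ) ^ (k + M - p) ≤ |τ₁| := by
    have h8 : (2 : ℚ) ^ (k + M - p + 3) = 8 * (2 : ℚ) ^ (k + M - p) := by
      rw [zpow_add₀ (by norm_num : (2 : ℚ) ≠ 0)]
      have : (2 : ℚ) ^ (3 : ℤ) = 8 := by norm_num
      rw [this]; ring
    rwa [h8] at h85'
  rcases lt_or_ge |τ₁| ((2 : ℚ) ^ (emin + p)) with hsmall | hbig
  · -- (8.6) fails: the exact case
    exact faithful_of_hugeNInv_small hfl hτ₂F hT₂le hI h85' hsmall hs'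
  · -- the main case `|τ₁| ≥ eps⁻¹eta` (8.6)
    obtain ⟨i, hlenτs, hqK, hexit⟩ := hI.last
    generalize hjL : (k + M - p + i * ((M : ℤ) - p) : ℤ) = jL at hqK hexit
    have hL : jL + M - p = k + M - p + (τs.length : ℤ) * ((M : ℤ) - p) := by
      rw [← hjL, hlenτs]; push_cast; ring
    -- (8.14): `K = 1 ∨ 3K ≤ M`, hence `3K ≤ p`; (8.15): `(1 + eps)^K ≤ 512/509`
    have hK3 : 3 * τs.length ≤ p := by
      rcases hI.three_mul_length_le h85' hM3 with h1 | h3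
      · omega
      · omega
    have hG := one_add_u_pow_le hp9 hK3
    have hG1 : 1 ≤ (1 + unitRoundoff p) ^ τs.length := one_le_pow₀ (by linarith)
    obtain ⟨A, D, hA, hA1, hAle, hD, hD1, hDle⟩ := nested_constants hp9 hM3
    -- (8.8)–(8.11) for `τ_{K+1}'`; (8.12), (8.13) for the nested sum started at `σ₀' = 2^(k+M−p)`
    obtain ⟨-, hcabs, hδK⟩ := lastPart_spec hp hfl hMp hn hnM hτ₂F hlenK hL hqK hexit
    have hcF : IsFloat p emin (fl (τ₂ + flSum fl qK)) := (hfl _).1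
    obtain ⟨hNF, hNabs, hNerr⟩ := nestedFlSum_spec hp hfl hA hA1 hD hD1 (abs_nonneg τ₂) hcF τs (k + M - p)
      hI.taus hcabs
    rw [pow_succ] at hNabs
    set c := fl (τ₂ + flSum fl qK) with hcdef
    set N := nestedFlSum fl τs c with hNdef
    -- `δ = s − (τ₁ + N) = (τ₂ + Σ q⁽ᴷ⁾ − τ_{K+1}') − (N − (Σ τ_k' + τ_{K+1}'))`
    have hδ : |s - (τ₁ + N)| ≤ |N - (τs.sum + c)| + |τ₂ + qK.sum - c| := by
      have : s - (τ₁ + N) = -(N - (τs.sum + c)) + (τ₂ + qK.sum - c) := by rw [hs']; ring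
      rw [this]
      refine (abs_add_le _ _).trans ?_
      rw [abs_neg]
    -- (8.15)–(8.18): the numerical constants
    obtain ⟨hN', hE⟩ := prop82_numerics hu0 hu hB0.le h85 (abs_nonneg τ₂) hT₂le hAle hD1 hDle hG1 hG
      hNabs hNerr hδK
    exact faithful_res_of_bounds hp hfl hu hτ₁F hNF hbig hN' (hδ.trans hE)

/-! ### Proposition 8.2 -/

/-- **PROPOSITION 8.2.** "Let `res` be the result of Algorithm 8.1 (`AccSumHugeN`) applied to a vector of
floating-point numbers `pᵢ`, `1 ≤ i ≤ n`. Define `M := ⌈log₂(n + 2)⌉`, and assume `2^(M+3)eps ≤ 1` and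
`eps ≤ 1/512`. Then `res` is a faithful rounding of `s := Σ pᵢ`." (The printed extra hypothesis
`1 < 2^(2M)eps` is not needed, see NOTES (a) and `isFaithfulRounding_accSumHugeN_printed`.) Proof: the zero
vector gives `res = 0 = s`; `σ ≤ ½eps⁻¹eta` gives `q⁽⁰⁾ = 0` and `res = τ₁ = fl(τ₁ + τ₂) = fl(s)` (Lemma 3.4);
otherwise `faithful_of_hugeNInv`. [cite: RumpOgitaOishi2009, Proposition 8.2] -/
theorem isFaithfulRounding_accSumHugeN (hfl : IsRoundNearest p emin fl) {xs : List ℚ}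
    (hxs : ∀ x ∈ xs, IsFloat p emin x) (hM3 : Nat.clog 2 (xs.length + 2) + 3 ≤ p) (hp9 : 9 ≤ p) :
    IsFaithfulRounding p emin (accSumHugeN fl p emin xs) xs.sum := by
  have hp : 1 ≤ p := by omega
  by_cases hμ : maxAbs xs = 0
  · -- the zero vector
    rw [accSumHugeN_of_maxAbs_eq_zero fl p emin hμ, List.sum_eq_zero (maxAbs_eq_zero_iff.mp hμ)]
    have := isFaithfulRounding_fl hfl (0 : ℚ)
    rwa [fl_eq_self hfl (isFloat_zero p emin)] at this
  · have hnil : xs ≠ [] := by rintro rfl; exact hμ rfl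
    have hn1 : 1 ≤ xs.length := by
      cases xs with
      | nil => exact absurd rfl hnil
      | cons _ _ => simp
    have hnM : xs.length + 2 ≤ 2 ^ Nat.clog 2 (xs.length + 2) := Nat.le_pow_clog (by norm_num) _
    have H := hugeNTransform_spec hp hfl hxs hμ hM3
    by_cases hσle : (hugeNTransform fl p emin xs).2.2.2 ≤ (2 : ℚ) ^ (emin + p - 1)
    · -- `σ ≤ ½eps⁻¹eta`: `q⁽⁰⁾ = 0`, `s = τ₁ + τ₂` and `res = τ₁ = fl(τ₁ + τ₂)`
      rw [accSumHugeN, if_pos hσle]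
      obtain ⟨-, hs0⟩ := H.eq_zero_of_le hσle
      rw [add_zero] at hs0
      have key := isFaithfulRounding_fl hfl ((hugeNTransform fl p emin xs).1 + (hugeNTransform fl p emin xs).2.1)
      rw [(H.fl_add_eq hp hfl).1] at key
      rw [hs0]
      exact key
    · have hσ : (2 : ℚ) ^ (emin + p - 1) < (hugeNTransform fl p emin xs).2.2.2 := not_le.mp hσle
      obtain ⟨k, hσk, -, hI, hsum, hlen, -⟩ := hugeNExtract_spec hfl hxs hμ hM3 hσ
      rw [accSumHugeN, if_neg hσle]
      have := faithful_of_hugeNInv hfl hp9 (M := Nat.clog 2 (xs.length + 2)) (by omega) hn1 hnM H hσ hσk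
        hI hsum hlen
      rwa [add_zero] at this

/-- **PROPOSITION 8.2, verbatim** — with the printed hypotheses `2^(M+3)eps ≤ 1`, `1 < 2^(2M)eps` and
`eps ≤ 1/512` ("we may assume `Φ := 2^(2M)eps > 1` because otherwise we can use Algorithm 4.5"; the middle
one is not used, see NOTES (a)). [cite: RumpOgitaOishi2009, Proposition 8.2] -/
theorem isFaithfulRounding_accSumHugeN_printed (hfl : IsRoundNearest p emin fl) {xs : List ℚ}
    (hxs : ∀ x ∈ xs, IsFloat p emin x) (hM3 : Nat.clog 2 (xs.length + 2) + 3 ≤ p)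
    (h2M : p < 2 * Nat.clog 2 (xs.length + 2)) (hp9 : 9 ≤ p) :
    IsFaithfulRounding p emin (accSumHugeN fl p emin xs) xs.sum := by
  have _ := h2M
  exact isFaithfulRounding_accSumHugeN hfl hxs hM3 hp9

/-- PROPOSITION 8.2 in the vocabulary `BoldoJeannerodMelquiondMuller2023.IsFaithful` (`f ∈ {RD(s), RU(s)}`,
[cite: BoldoEtAl2023, §2]): `AccSumHugeN(p)` is a faithful rounding of `Σ pᵢ`.
[cite: RumpOgitaOishi2009, Proposition 8.2] -/
theorem isFaithful_accSumHugeN (hfl : IsRoundNearest p emin fl) {xs : List ℚ}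
    (hxs : ∀ x ∈ xs, IsFloat p emin x) (hM3 : Nat.clog 2 (xs.length + 2) + 3 ≤ p) (hp9 : 9 ≤ p) :
    IsFaithful p emin xs.sum (accSumHugeN fl p emin xs) :=
  isFaithfulRounding_iff_isFaithful.mp (isFaithfulRounding_accSumHugeN hfl hxs hM3 hp9)

end Literature.ComputerArithmetic.RumpOgitaOishi2009
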